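import Mathlib.Algebra.CharP.Reduced
import Mathlib.GroupTheory.Index
import Mathlib.GroupTheory.PGroup
import Mathlib.GroupTheory.Perm.Cycle.Type
import Mathlib.Topology.Compactification.OnePoint.ProjectiveLine
import Literature.NumberTheory.GaloisRepresentations.CalegariEvenFontaineMazurTwo
import Literature.GroupTheory.SpecificGroups.PGL2DicksonCharP
import Literature.NumberTheory.GaloisRepresentations.EnormousSubgroup
import HarnessLib

/-!
# `Sym² H ≤ GL₃(𝔽̄_l)` is enormous for `H ⊇ SL₂(𝔽_l)` finite, `l > 7` (ACC+ Lemma 7.1.5, `n = 3`)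

Topic `NumberTheory/GaloisRepresentations`; theorems only (no definitions, no named facts).  This
file proves the named fact `ACC_symmSq_enormous_of_specialLinearGroup_le` of
`SymmPowerEnormous.lean`: P. B. Allen, F. Calegari, A. Caraiani, T. Gee, D. Helm, B. V. Le Hung,
J. Newton, P. Scholze, R. Taylor, J. A. Thorne, *Potential automorphy over CM fields*, Ann. of
Math. (2) 197 (2023), §7.1, Lemma 7.1.5 [ACCGHLNSTT2023], in the case `n = 3`: if `l > 7` and
`H ≤ GL₂(𝔽̄_l)` is finite and contains `SL₂(𝔽_l)`, then `Sym² H ≤ GL₃(𝔽̄_l)` is enormous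
(`Subgroup.IsEnormous`, ACC+ Def. 6.2.28, file `EnormousSubgroup`), see
`SymmSqEnormous.isEnormous_map_symSq`.

## The proof

The printed proof is two sentences: "The image of `H` in `PGL₂(𝔽̄_l)` must be conjugate to
`PSL₂(k)` or `PGL₂(k)` for some finite extension `k/𝔽_l` (Dickson). Thus
`𝔽̄_lˣ Symm^{n-1} GL₂(k) ⊃ H ⊃ Symm^{n-1} SL₂(k)`, and the lemma follows from [the standard
computation]."  We follow it, supplying the standard computation by hand:

* **Dickson** is the tree's `PGL2.exists_smul_eq_or_exists_conj_eq_of_five_le`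
  (`GroupTheory/SpecificGroups/PGL2DicksonCharP`); the image of `H` fixes no point of `ℙ¹`
  because it contains the translation `z ↦ z + 1` and the lower unipotent `(1 0; 1 1)`.
* **Normal form** (section `NormalForm`, `FromProjective`): after conjugating, `H` contains the
  translations `(1 c; 0 1)`, `c ∈ F` (`hasTransl_of_pslTwo_le`: a scalar multiple lies in `H`,
  and raising to the prime-to-`l` part of its order kills the scalar), a scalar multiple of
  `diag(d, d⁻¹)` for `d ∈ Fˣ` (`hasTorus_of_pslTwo_le`), and consists of scalar multiples of
  `F`-rational matrices (`isRational_of_le_pglTwo`); its diagonal part has order prime to `l`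
  (`not_dvd_card_of_diag`, Cauchy + injectivity of Frobenius) and its upper triangular part has
  index prime to `l` (`not_dvd_relIndex_borel`, from `|H| = |H ∩ Z|·|H̄|`, `|F| ∣ |H ∩ B|` and the
  orders of `PSL₂(F)`, `PGL₂(F)`).
* **(1) no `l`-group quotient** (`card_eq_one_of_normalForm`): an `l`-group image kills the
  diagonal part, hence the translations (`t u t⁻¹ = u⁴` forces `ψ(u)³ = 1 = ψ(u)ˡ`), hence the
  Borel part, whose index is prime to `l`.
* **(2b) `H¹(Sym² H, ad⁰) = 0`** (`exists_coboundary_of_normalForm`): average over the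
  diagonal part (`exists_coboundary_of_card`), solve the cocycle equation on the translations
  explicitly (`borel_cocycle`: ascending-weight computation in `Matrix (Fin 3) (Fin 3) k`, valid for
  `char ∉ {2,3,5,7}` — this is where `l > 7` enters, `H¹(SL₂(𝔽₇), Sym⁴) ≠ 0`), extend to the
  Borel subgroup by the Borel decomposition, and use the injectivity of restriction to a subgroup
  of index prime to `l` (`exists_coboundary_of_relIndex`); conjugation invariance
  (`exists_coboundary_of_conj`) brings the statement back to `H`.
* **(2a) `H⁰ = 0`** and **(3)** (section `Explicit`, `Assembly`): conjugation by
  `Sym² diag(2, 2⁻¹) = diag(4, 1, 4⁻¹)` acts on the matrix units by five distinct characters,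
  so a polynomial in it projects onto the diagonal (`diag_projector`); together with the
  conjugates by `Sym²(1 ±1; 0 1)`, `Sym²(1 0; ±1 1)` this shows that an invariant trace-zero
  matrix vanishes (`eq_zero_of_invariant`) and that every non-zero stable subspace of `ad⁰`
  contains a non-zero diagonal matrix, fixed by the regular semisimple `diag(4, 1, 4⁻¹)`.

All statements about `Sym²` use the tree's matrix `TernaryPairs.symSq`
(`symSq (a b; c d) = (a² ab b²; 2ac ad+bc 2bd; c² cd d²)`) through
`Matrix.GeneralLinearGroup.symSq` (`CalegariEvenFontaineMazurTwo`).  The file introduces no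
definition and no notation; in the statements the following are written out in full:
`Sym² a` is `((Matrix.GeneralLinearGroup.symSq a : GL (Fin 3) k) : Matrix (Fin 3) (Fin 3) k)`;
`U(c) = Sym²(1 c; 0 1)` is `!![1, c, c²; 0, 1, 2c; 0, 0, 1]` and `L(c) = Sym²(1 0; c 1)` is
`!![1, 0, 0; 2c, 1, 0; c², c, 1]`; "`f` is a `1`-cocycle on `H`" is
`∀ a₁ ∈ H, ∀ b₁ ∈ H, f (a₁ b₁) = Sym² a₁ · f b₁ · Sym² a₁⁻¹ + f a₁`; the Borel subgroup of
`GL₂(k)` is `MulAction.stabilizer (GL (Fin 2) k) ∞` (`∞ ∈ OnePoint k = ℙ¹(k)`, membership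
`g₁₀ = 0`, `mem_borel_iff`) and the diagonal subgroup is its intersection with the stabiliser
of `0` (`mem_diag_iff`); the normal-form hypotheses "`H` contains the translations by `F`",
"`H` contains a scalar multiple of `diag(d², 1)` for `d ∈ Fˣ`" and "`H` consists of scalar
multiples of `F`-rational matrices" are the three displayed `∀`-hypotheses `hU`, `hT`, `hF`.

## References

* [ACCGHLNSTT2023] P. B. Allen et al., *Potential automorphy over CM fields*, Ann. of Math. (2)
  197 (2023), 897–1113, §7.1, Lemma 7.1.5; Def. 6.2.28 (arXiv:1812.09999, read 2026-08-17:
  Lemma `lemen`, p. 98 of the arXiv text).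
* [Faber2011] X. Faber, *Finite p-irregular subgroups of PGL₂(k)*, arXiv:1112.1999 (Dickson's
  theorem as used here, via the tree's `PGL2DicksonCharP`).
-/

open scoped MatrixGroups OnePoint
open Matrix

namespace Literature.NumberTheory.GaloisRepresentations

namespace SymmSqEnormous

variable {k : Type*} [Field k]






/-- `Sym²` of the translation `(1 c; 0 1)` is `(1 c c²; 0 1 2c; 0 0 1)`. [folklore] -/
theorem symSq_transl (c : k) :
    Literature.NumberTheory.EllipticCurves.TernaryPairs.symSq !![(1 : k), c; 0, 1] = (!![(1 : k),
        (c), (c) ^ 2; 0, 1, 2 * (c); 0, 0, 1] : Matrix (Fin 3) (Fin 3) k) := by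
  ext i j
  fin_cases i <;> fin_cases j <;>
    simp [Literature.NumberTheory.EllipticCurves.TernaryPairs.symSq]

/-- `U(0) = 1`. [folklore] -/
theorem transl3_zero : (!![(1 : k), ((0 : k)), ((0 : k)) ^ 2; 0, 1, 2 * ((0 : k)); 0, 0, 1] : Matrix
    (Fin 3) (Fin 3) k) = 1 := by
  ext i j
  fin_cases i <;> fin_cases j <;> simp

/-- `U(c) U(c') = U(c + c')`. [folklore] -/
theorem transl3_mul (c c' : k) : (!![(1 : k), (c), (c) ^ 2; 0, 1, 2 * (c); 0, 0, 1] : Matrix (Fin 3)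
    (Fin 3) k) * (!![(1 : k), (c'), (c') ^ 2; 0, 1, 2 * (c'); 0, 0, 1] : Matrix (Fin 3) (Fin 3)
    k) = (!![(1 : k), (c + c'), (c + c') ^ 2; 0, 1, 2 * (c + c'); 0, 0, 1] : Matrix (Fin 3) (Fin 3)
    k) := by
  ext i j
  fin_cases i <;> fin_cases j <;> simp [Matrix.mul_apply, Fin.sum_univ_three] <;> ring

/-- **Conjugation by `U(c)`**, entrywise: the matrix `U(c) X U(-c)`. [folklore] -/
theorem transl3_conj (c : k) (X : Matrix (Fin 3) (Fin 3) k) :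
    (!![(1 : k), (c), (c) ^ 2; 0, 1, 2 * (c); 0, 0, 1] : Matrix (Fin 3) (Fin 3) k) * X * (!![(1 :
        k), (-c), (-c) ^ 2; 0, 1, 2 * (-c); 0, 0, 1] : Matrix (Fin 3) (Fin 3) k) =
      !![X 0 0 + c * X 1 0 + c ^ 2 * X 2 0,
          X 0 1 + c * (X 1 1 - X 0 0) - c ^ 2 * X 1 0 + c ^ 2 * X 2 1 - c ^ 3 * X 2 0,
          X 0 2 + c * (X 1 2 - 2 * X 0 1) + c ^ 2 * (X 0 0 - 2 * X 1 1 + X 2 2)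
            + c ^ 3 * (X 1 0 - 2 * X 2 1) + c ^ 4 * X 2 0;
         X 1 0 + 2 * c * X 2 0,
          X 1 1 - c * X 1 0 + 2 * c * X 2 1 - 2 * c ^ 2 * X 2 0,
          X 1 2 + 2 * c * (X 2 2 - X 1 1) + c ^ 2 * X 1 0 - 4 * c ^ 2 * X 2 1 + 2 * c ^ 3 * X 2 0;
         X 2 0,
          X 2 1 - c * X 2 0,
          X 2 2 + c ^ 2 * X 2 0 - 2 * c * X 2 1] := by
  ext i j
  simp only [Matrix.mul_apply, Fin.sum_univ_three]
  fin_cases i <;> fin_cases j <;> simp <;> ring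

/-- Conjugation by a diagonal matrix, entrywise. [folklore] -/
theorem diagonal_conj_apply (t t' : Fin 3 → k) (X : Matrix (Fin 3) (Fin 3) k) (i j : Fin 3) :
    (diagonal t * X * diagonal t') i j = t i * X i j * t' j := by
  simp [Matrix.mul_diagonal, Matrix.diagonal_mul, mul_assoc]


/-! ### The Borel cocycle lemma

Let `F ≤ k` be a subfield and `φ : k → Matrix (Fin 3) (Fin
    3) k(k)` a function which on `F` is a `1`-cocycle for the
translations, `φ (c + c') = φ c + U(c) φ(c') U(c)⁻¹`, and is equivariant for the torus,
`φ (d² c) = T_d φ(c) T_d⁻¹` with `T_d = diag(d², 1, d⁻²) = Sym² diag(d, d⁻¹)`, for `d ∈ Fˣ`.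
If `char k ∉ {2, 3, 5, 7}` then `φ (c) = U(c) v U(c)⁻¹ - v` for a trace-zero diagonal `v`:
the restriction to the Borel subgroup of a `1`-cocycle of `Sym² SL₂(F)` on `ad⁰ ⊂ Matrix (Fin
    3) (Fin 3) k` that
vanishes on the torus is the coboundary of a torus-fixed vector.  The proof is by ascending
weight: the entries `(2,0)`, `(1,0)`, `(2,1)` and the diagonal entries are additive in `c` of
the wrong homogeneity degree, hence vanish; the entries `(0,1)`, `(1,2)` are additive and
homogeneous of degree one for squares, hence `F`-linear (`a = ((a+1)/2)² - ((a-1)/2)²`); the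
entry `(0,2)` is then forced to be `κ c² / 2`. -/

section Borel

variable {F : Subfield k} {φ : k → Matrix (Fin 3) (Fin 3) k}

/-- An additive function on `F` with `a α(4c) = b α(c)`, `b ≠ 4a`, vanishes on `F`. [folklore] -/
theorem eq_zero_of_additive_of_hom {α : k → k}
    (hα : ∀ c ∈ F, ∀ c' ∈ F, α (c + c') = α c + α c') {a b : k} (hw : b - 4 * a ≠ 0)
    (hhom : ∀ c ∈ F, α (2 ^ 2 * c) * a = b * α c) : ∀ c ∈ F, α c = 0 := by
  intro c hc
  have h2c : c + c ∈ F := F.add_mem hc hc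
  have h4 : α (2 ^ 2 * c) = 4 * α c := by
    rw [show (2 : k) ^ 2 * c = (c + c) + (c + c) by ring, hα _ h2c _ h2c, hα _ hc _ hc]
    ring
  have h0 : (b - 4 * a) * α c = 0 := by linear_combination (-1 : k) * hhom c hc + a * h4
  rcases mul_eq_zero.mp h0 with h | h
  · exact absurd h hw
  · exact h

/-- An additive function on `F` vanishes at `0`. [folklore] -/
theorem additive_zero {α : k → k} (hα : ∀ c ∈ F, ∀ c' ∈ F, α (c + c') = α c + α c') :
    α 0 = 0 := by
  have h := hα 0 F.zero_mem 0 F.zero_mem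
  rw [add_zero] at h
  linear_combination -h

/-- An additive function on `F` is subtractive. [folklore] -/
theorem additive_sub {α : k → k} (hα : ∀ c ∈ F, ∀ c' ∈ F, α (c + c') = α c + α c')
    {x y : k} (hx : x ∈ F) (hy : y ∈ F) : α (x - y) = α x - α y := by
  have h := hα (x - y) (F.sub_mem hx hy) y hy
  rw [sub_add_cancel] at h
  linear_combination -h

/-- **Linearity from additivity and homogeneity for squares** (`char k ≠ 2`): an additive
function on `F` with `α(d² c) = d² α(c)` for `d ∈ Fˣ` is `F`-linear, because every `a ∈ F` is a
difference of two squares, `a = ((a+1)/2)² - ((a-1)/2)²`. [folklore] -/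
theorem linear_of_additive_of_hom (h2 : (2 : k) ≠ 0) {α : k → k}
    (hα : ∀ c ∈ F, ∀ c' ∈ F, α (c + c') = α c + α c')
    (hhom : ∀ d ∈ F, d ≠ 0 → ∀ c ∈ F, α (d ^ 2 * c) = d ^ 2 * α c) :
    ∀ a ∈ F, α a = a * α 1 := by
  have h2F : (2 : k) ∈ F := by simp
  have hsq : ∀ d ∈ F, α (d ^ 2 * 1) = d ^ 2 * α 1 := by
    intro d hd
    by_cases hd0 : d = 0
    · rw [hd0, zero_pow two_ne_zero, zero_mul, zero_mul, additive_zero hα]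
    · exact hhom d hd hd0 1 F.one_mem
  intro a ha
  have hd₁ : (a + 1) / 2 ∈ F := F.div_mem (F.add_mem ha F.one_mem) h2F
  have hd₂ : (a - 1) / 2 ∈ F := F.div_mem (F.sub_mem ha F.one_mem) h2F
  have key : a = ((a + 1) / 2) ^ 2 * 1 - ((a - 1) / 2) ^ 2 * 1 := by
    field_simp
    ring
  conv_lhs => rw [key]
  rw [additive_sub hα (F.mul_mem (F.pow_mem hd₁ 2) F.one_mem)
    (F.mul_mem (F.pow_mem hd₂ 2) F.one_mem), hsq _ hd₁, hsq _ hd₂]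
  field_simp
  ring

/-- Entrywise form of the cocycle identity. [folklore] -/
theorem borel_add_apply (hadd : (∀ c₁ ∈ ((F) : Subfield k), ∀ c₂ ∈ (F), ((φ) : k → Matrix (Fin 3)
    (Fin 3) k) (c₁ + c₂) = (φ) c₁ + (!![(1 : k), (c₁), (c₁) ^ 2; 0, 1, 2 * (c₁); 0, 0, 1] : Matrix
    (Fin 3) (Fin 3) k) * (φ) c₂ * (!![(1 : k), (-c₁), (-c₁) ^ 2; 0, 1, 2 * (-c₁); 0, 0, 1] : Matrix
    (Fin 3) (Fin 3) k))) {c c' : k} (hc : c ∈ F) (hc' : c' ∈ F)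
    (i j : Fin 3) : φ (c + c') i j = φ c i j + ((!![(1 : k), (c), (c) ^ 2; 0, 1, 2 * (c); 0, 0, 1] :
        Matrix (Fin 3) (Fin 3) k) * φ c' * (!![(1 : k), (-c), (-c) ^ 2; 0, 1, 2 * (-c); 0, 0, 1] :
        Matrix (Fin 3) (Fin 3) k)) i j := by
  rw [hadd c hc c' hc', Matrix.add_apply]

/-- Entrywise form of the torus equivariance. [folklore] -/
theorem borel_hom_apply (hhom : (∀ d₁ ∈ ((F) : Subfield k), d₁ ≠ 0 → ∀ c₁ ∈ (F), ((φ) : k → Matrix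
    (Fin 3) (Fin 3) k) (d₁ ^ 2 * c₁) * diagonal ![d₁ ^ 4, d₁ ^ 2, 1] = diagonal ![d₁ ^ 4, d₁ ^ 2, 1]
    * (φ) c₁)) {d c : k} (hd : d ∈ F) (hd0 : d ≠ 0)
    (hc : c ∈ F) (i j : Fin 3) :
    φ (d ^ 2 * c) i j * ![d ^ 4, d ^ 2, 1] j = ![d ^ 4, d ^ 2, 1] i * φ c i j := by
  have h := congrFun (congrFun (hhom d hd hd0 c hc) i) j
  rwa [Matrix.mul_diagonal, Matrix.diagonal_mul] at h

/-- Step 1: the entry `(2,0)` (lowest weight) vanishes. [folklore] -/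
theorem borel_apply_two_zero (hadd : (∀ c₁ ∈ ((F) : Subfield k), ∀ c₂ ∈ (F), ((φ) : k → Matrix (Fin
    3) (Fin 3) k) (c₁ + c₂) = (φ) c₁ + (!![(1 : k), (c₁), (c₁) ^ 2; 0, 1, 2 * (c₁); 0, 0, 1] :
    Matrix (Fin 3) (Fin 3) k) * (φ) c₂ * (!![(1 : k), (-c₁), (-c₁) ^ 2; 0, 1, 2 * (-c₁); 0, 0, 1] :
    Matrix (Fin 3) (Fin 3) k))) (hhom : (∀ d₁ ∈ ((F) : Subfield k), d₁ ≠ 0 → ∀ c₁ ∈ (F), ((φ) : k →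
    Matrix (Fin 3) (Fin 3) k) (d₁ ^ 2 * c₁) * diagonal ![d₁ ^ 4, d₁ ^ 2, 1] = diagonal ![d₁ ^ 4, d₁
    ^ 2, 1] * (φ) c₁))
    (h2 : (2 : k) ≠ 0) (h63 : (63 : k) ≠ 0) :
    ∀ c ∈ F, φ c 2 0 = 0 := by
  have h2F : (2 : k) ∈ F := by simp
  refine eq_zero_of_additive_of_hom (α := fun c => φ c 2 0) (a := 2 ^ 4) (b := 1) ?_ ?_ ?_
  · intro c hc c' hc'
    have h := borel_add_apply hadd hc hc' 2 0
    rw [transl3_conj] at h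
    simp at h
    linear_combination h
  · intro h
    exact h63 (by linear_combination -h)
  · intro c hc
    have h := borel_hom_apply hhom h2F h2 hc 2 0
    simp at h
    linear_combination h

/-- Step 2: the entry `(1,0)` vanishes. [folklore] -/
theorem borel_apply_one_zero (hadd : (∀ c₁ ∈ ((F) : Subfield k), ∀ c₂ ∈ (F), ((φ) : k → Matrix (Fin
    3) (Fin 3) k) (c₁ + c₂) = (φ) c₁ + (!![(1 : k), (c₁), (c₁) ^ 2; 0, 1, 2 * (c₁); 0, 0, 1] :
    Matrix (Fin 3) (Fin 3) k) * (φ) c₂ * (!![(1 : k), (-c₁), (-c₁) ^ 2; 0, 1, 2 * (-c₁); 0, 0, 1] :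
    Matrix (Fin 3) (Fin 3) k))) (hhom : (∀ d₁ ∈ ((F) : Subfield k), d₁ ≠ 0 → ∀ c₁ ∈ (F), ((φ) : k →
    Matrix (Fin 3) (Fin 3) k) (d₁ ^ 2 * c₁) * diagonal ![d₁ ^ 4, d₁ ^ 2, 1] = diagonal ![d₁ ^ 4, d₁
    ^ 2, 1] * (φ) c₁))
    (h2 : (2 : k) ≠ 0) (h15 : (15 : k) ≠ 0) (h20 : ∀ c ∈ F, φ c 2 0 = 0) :
    ∀ c ∈ F, φ c 1 0 = 0 := by
  have h2F : (2 : k) ∈ F := by simp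
  refine eq_zero_of_additive_of_hom (α := fun c => φ c 1 0) (a := 2 ^ 4) (b := 2 ^ 2) ?_ ?_ ?_
  · intro c hc c' hc'
    have h := borel_add_apply hadd hc hc' 1 0
    rw [transl3_conj] at h
    simp [h20 c' hc'] at h
    linear_combination h
  · intro h
    have h60 : (60 : k) ≠ 0 := by
      rw [show (60 : k) = 2 * 2 * 15 by norm_num]
      simp [h2, h15]
    exact h60 (by linear_combination -h)
  · intro c hc
    have h := borel_hom_apply hhom h2F h2 hc 1 0
    simp at h
    linear_combination h

/-- Step 2': the entry `(2,1)` vanishes. [folklore] -/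
theorem borel_apply_two_one (hadd : (∀ c₁ ∈ ((F) : Subfield k), ∀ c₂ ∈ (F), ((φ) : k → Matrix (Fin
    3) (Fin 3) k) (c₁ + c₂) = (φ) c₁ + (!![(1 : k), (c₁), (c₁) ^ 2; 0, 1, 2 * (c₁); 0, 0, 1] :
    Matrix (Fin 3) (Fin 3) k) * (φ) c₂ * (!![(1 : k), (-c₁), (-c₁) ^ 2; 0, 1, 2 * (-c₁); 0, 0, 1] :
    Matrix (Fin 3) (Fin 3) k))) (hhom : (∀ d₁ ∈ ((F) : Subfield k), d₁ ≠ 0 → ∀ c₁ ∈ (F), ((φ) : k →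
    Matrix (Fin 3) (Fin 3) k) (d₁ ^ 2 * c₁) * diagonal ![d₁ ^ 4, d₁ ^ 2, 1] = diagonal ![d₁ ^ 4, d₁
    ^ 2, 1] * (φ) c₁))
    (h2 : (2 : k) ≠ 0) (h15 : (15 : k) ≠ 0) (h20 : ∀ c ∈ F, φ c 2 0 = 0) :
    ∀ c ∈ F, φ c 2 1 = 0 := by
  have h2F : (2 : k) ∈ F := by simp
  refine eq_zero_of_additive_of_hom (α := fun c => φ c 2 1) (a := 2 ^ 2) (b := 1) ?_ ?_ ?_
  · intro c hc c' hc'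
    have h := borel_add_apply hadd hc hc' 2 1
    rw [transl3_conj] at h
    simp [h20 c' hc'] at h
    linear_combination h
  · intro h
    exact h15 (by linear_combination -h)
  · intro c hc
    have h := borel_hom_apply hhom h2F h2 hc 2 1
    simp at h
    linear_combination h

/-- Step 3: the diagonal entries vanish. [folklore] -/
theorem borel_apply_diag (hadd : (∀ c₁ ∈ ((F) : Subfield k), ∀ c₂ ∈ (F), ((φ) : k → Matrix (Fin 3)
    (Fin 3) k) (c₁ + c₂) = (φ) c₁ + (!![(1 : k), (c₁), (c₁) ^ 2; 0, 1, 2 * (c₁); 0, 0, 1] : Matrix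
    (Fin 3) (Fin 3) k) * (φ) c₂ * (!![(1 : k), (-c₁), (-c₁) ^ 2; 0, 1, 2 * (-c₁); 0, 0, 1] : Matrix
    (Fin 3) (Fin 3) k))) (hhom : (∀ d₁ ∈ ((F) : Subfield k), d₁ ≠ 0 → ∀ c₁ ∈ (F), ((φ) : k → Matrix
    (Fin 3) (Fin 3) k) (d₁ ^ 2 * c₁) * diagonal ![d₁ ^ 4, d₁ ^ 2, 1] = diagonal ![d₁ ^ 4, d₁ ^ 2, 1]
    * (φ) c₁))
    (h2 : (2 : k) ≠ 0) (h3 : (3 : k) ≠ 0) (h20 : ∀ c ∈ F, φ c 2 0 = 0)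
    (h10 : ∀ c ∈ F, φ c 1 0 = 0) (h21 : ∀ c ∈ F, φ c 2 1 = 0) :
    ∀ c ∈ F, φ c 0 0 = 0 ∧ φ c 1 1 = 0 ∧ φ c 2 2 = 0 := by
  have h2F : (2 : k) ∈ F := by simp
  have h12 : (12 : k) ≠ 0 := by
    rw [show (12 : k) = 2 * 2 * 3 by norm_num]
    simp [h2, h3]
  have h48 : (48 : k) ≠ 0 := by
    rw [show (48 : k) = 2 * 2 * 12 by norm_num]
    simp [h2, h12]
  have H00 : ∀ c ∈ F, φ c 0 0 = 0 := by
    refine eq_zero_of_additive_of_hom (α := fun c => φ c 0 0) (a := 2 ^ 4) (b := 2 ^ 4) ?_ ?_ ?_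
    · intro c hc c' hc'
      have h := borel_add_apply hadd hc hc' 0 0
      rw [transl3_conj] at h
      simp [h20 c' hc', h10 c' hc'] at h
      linear_combination h
    · intro h
      exact h48 (by linear_combination -h)
    · intro c hc
      have h := borel_hom_apply hhom h2F h2 hc 0 0
      simp at h
      linear_combination h
  have H11 : ∀ c ∈ F, φ c 1 1 = 0 := by
    refine eq_zero_of_additive_of_hom (α := fun c => φ c 1 1) (a := 2 ^ 2) (b := 2 ^ 2) ?_ ?_ ?_
    · intro c hc c' hc'
      have h := borel_add_apply hadd hc hc' 1 1
      rw [transl3_conj] at h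
      simp [h20 c' hc', h10 c' hc', h21 c' hc'] at h
      linear_combination h
    · intro h
      exact h12 (by linear_combination -h)
    · intro c hc
      have h := borel_hom_apply hhom h2F h2 hc 1 1
      simp at h
      linear_combination h
  have H22 : ∀ c ∈ F, φ c 2 2 = 0 := by
    refine eq_zero_of_additive_of_hom (α := fun c => φ c 2 2) (a := 1) (b := 1) ?_ ?_ ?_
    · intro c hc c' hc'
      have h := borel_add_apply hadd hc hc' 2 2
      rw [transl3_conj] at h
      simp [h20 c' hc', h21 c' hc'] at h
      linear_combination h
    · intro h
      exact h3 (by linear_combination -h)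
    · intro c hc
      have h := borel_hom_apply hhom h2F h2 hc 2 2
      simp at h
      linear_combination h
  exact fun c hc => ⟨H00 c hc, H11 c hc, H22 c hc⟩

/-- Step 4: the entry `(0,1)` is `F`-linear. [folklore] -/
theorem borel_apply_zero_one (hadd : (∀ c₁ ∈ ((F) : Subfield k), ∀ c₂ ∈ (F), ((φ) : k → Matrix (Fin
    3) (Fin 3) k) (c₁ + c₂) = (φ) c₁ + (!![(1 : k), (c₁), (c₁) ^ 2; 0, 1, 2 * (c₁); 0, 0, 1] :
    Matrix (Fin 3) (Fin 3) k) * (φ) c₂ * (!![(1 : k), (-c₁), (-c₁) ^ 2; 0, 1, 2 * (-c₁); 0, 0, 1] :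
    Matrix (Fin 3) (Fin 3) k))) (hhom : (∀ d₁ ∈ ((F) : Subfield k), d₁ ≠ 0 → ∀ c₁ ∈ (F), ((φ) : k →
    Matrix (Fin 3) (Fin 3) k) (d₁ ^ 2 * c₁) * diagonal ![d₁ ^ 4, d₁ ^ 2, 1] = diagonal ![d₁ ^ 4, d₁
    ^ 2, 1] * (φ) c₁))
    (h2 : (2 : k) ≠ 0) (h20 : ∀ c ∈ F, φ c 2 0 = 0) (h10 : ∀ c ∈ F, φ c 1 0 = 0)
    (h21 : ∀ c ∈ F, φ c 2 1 = 0) (hdiag : ∀ c ∈ F, φ c 0 0 = 0 ∧ φ c 1 1 = 0 ∧ φ c 2 2 = 0) :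
    ∀ c ∈ F, φ c 0 1 = c * φ 1 0 1 := by
  refine linear_of_additive_of_hom h2 (α := fun c => φ c 0 1) ?_ ?_
  · intro c hc c' hc'
    have h := borel_add_apply hadd hc hc' 0 1
    rw [transl3_conj] at h
    simp [h20 c' hc', h10 c' hc', h21 c' hc', (hdiag c' hc').1, (hdiag c' hc').2.1] at h
    linear_combination h
  · intro d hd hd0 c hc
    have h := borel_hom_apply hhom hd hd0 hc 0 1
    simp at h
    apply mul_right_cancel₀ (pow_ne_zero 2 hd0)
    linear_combination h

/-- Step 4': the entry `(1,2)` is `F`-linear. [folklore] -/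
theorem borel_apply_one_two (hadd : (∀ c₁ ∈ ((F) : Subfield k), ∀ c₂ ∈ (F), ((φ) : k → Matrix (Fin
    3) (Fin 3) k) (c₁ + c₂) = (φ) c₁ + (!![(1 : k), (c₁), (c₁) ^ 2; 0, 1, 2 * (c₁); 0, 0, 1] :
    Matrix (Fin 3) (Fin 3) k) * (φ) c₂ * (!![(1 : k), (-c₁), (-c₁) ^ 2; 0, 1, 2 * (-c₁); 0, 0, 1] :
    Matrix (Fin 3) (Fin 3) k))) (hhom : (∀ d₁ ∈ ((F) : Subfield k), d₁ ≠ 0 → ∀ c₁ ∈ (F), ((φ) : k →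
    Matrix (Fin 3) (Fin 3) k) (d₁ ^ 2 * c₁) * diagonal ![d₁ ^ 4, d₁ ^ 2, 1] = diagonal ![d₁ ^ 4, d₁
    ^ 2, 1] * (φ) c₁))
    (h2 : (2 : k) ≠ 0) (h20 : ∀ c ∈ F, φ c 2 0 = 0) (h10 : ∀ c ∈ F, φ c 1 0 = 0)
    (h21 : ∀ c ∈ F, φ c 2 1 = 0) (hdiag : ∀ c ∈ F, φ c 0 0 = 0 ∧ φ c 1 1 = 0 ∧ φ c 2 2 = 0) :
    ∀ c ∈ F, φ c 1 2 = c * φ 1 1 2 := by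
  refine linear_of_additive_of_hom h2 (α := fun c => φ c 1 2) ?_ ?_
  · intro c hc c' hc'
    have h := borel_add_apply hadd hc hc' 1 2
    rw [transl3_conj] at h
    simp [h20 c' hc', h10 c' hc', h21 c' hc', (hdiag c' hc').2.1, (hdiag c' hc').2.2] at h
    linear_combination h
  · intro d hd hd0 c hc
    have h := borel_hom_apply hhom hd hd0 hc 1 2
    simp at h
    linear_combination h

/-- Step 5: the entry `(0,2)` is `κ c² / 2` with `κ = φ(1)₁₂ - 2 φ(1)₀₁`. [folklore] -/
theorem borel_apply_zero_two (hadd : (∀ c₁ ∈ ((F) : Subfield k), ∀ c₂ ∈ (F), ((φ) : k → Matrix (Fin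
    3) (Fin 3) k) (c₁ + c₂) = (φ) c₁ + (!![(1 : k), (c₁), (c₁) ^ 2; 0, 1, 2 * (c₁); 0, 0, 1] :
    Matrix (Fin 3) (Fin 3) k) * (φ) c₂ * (!![(1 : k), (-c₁), (-c₁) ^ 2; 0, 1, 2 * (-c₁); 0, 0, 1] :
    Matrix (Fin 3) (Fin 3) k))) (hhom : (∀ d₁ ∈ ((F) : Subfield k), d₁ ≠ 0 → ∀ c₁ ∈ (F), ((φ) : k →
    Matrix (Fin 3) (Fin 3) k) (d₁ ^ 2 * c₁) * diagonal ![d₁ ^ 4, d₁ ^ 2, 1] = diagonal ![d₁ ^ 4, d₁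
    ^ 2, 1] * (φ) c₁))
    (h2 : (2 : k) ≠ 0) (h3 : (3 : k) ≠ 0) (h20 : ∀ c ∈ F, φ c 2 0 = 0)
    (h10 : ∀ c ∈ F, φ c 1 0 = 0) (h21 : ∀ c ∈ F, φ c 2 1 = 0)
    (hdiag : ∀ c ∈ F, φ c 0 0 = 0 ∧ φ c 1 1 = 0 ∧ φ c 2 2 = 0)
    (h01 : ∀ c ∈ F, φ c 0 1 = c * φ 1 0 1) (h12 : ∀ c ∈ F, φ c 1 2 = c * φ 1 1 2) :
    ∀ c ∈ F, 2 * φ c 0 2 = c ^ 2 * (φ 1 1 2 - 2 * φ 1 0 1) := by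
  have h2F : (2 : k) ∈ F := by simp
  have h6 : (6 : k) ≠ 0 := by
    rw [show (6 : k) = 2 * 3 by norm_num]
    simp [h2, h3]
  -- the addition formula for the entry `(0,2)`
  have hγ : ∀ c ∈ F, ∀ c' ∈ F,
      φ (c + c') 0 2 = φ c 0 2 + φ c' 0 2 + c * c' * (φ 1 1 2 - 2 * φ 1 0 1) := by
    intro c hc c' hc'
    have h := borel_add_apply hadd hc hc' 0 2
    rw [transl3_conj] at h
    simp [h20 c' hc', h10 c' hc', h21 c' hc', (hdiag c' hc').1, (hdiag c' hc').2.1,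
      (hdiag c' hc').2.2, h01 c' hc', h12 c' hc'] at h
    linear_combination h
  intro c hc
  have h2c : c + c ∈ F := F.add_mem hc hc
  have h4 : φ (2 ^ 2 * c) 0 2 = 4 * φ c 0 2 + 6 * c ^ 2 * (φ 1 1 2 - 2 * φ 1 0 1) := by
    rw [show (2 : k) ^ 2 * c = (c + c) + (c + c) by ring, hγ _ h2c _ h2c, hγ _ hc _ hc]
    ring
  have h16 : φ (2 ^ 2 * c) 0 2 = 2 ^ 4 * φ c 0 2 := by
    have h := borel_hom_apply hhom h2F h2 hc 0 2
    simp at h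
    linear_combination h
  apply mul_left_cancel₀ h6
  linear_combination h4 - h16

/-- **The Borel cocycle lemma.**  For `char k ∉ {2, 3, 5, 7}`, a function `φ : k → Matrix (Fin
    3) (Fin 3) k(k)` which
on the subfield `F` is a `1`-cocycle for the translations `U(c) = Sym² (1 c; 0 1)` and
equivariant for the torus `Sym² diag(d, d⁻¹)`, `d ∈ Fˣ`, is on `F` the coboundary of a
trace-zero diagonal matrix: `φ (c) = U(c) v U(c)⁻¹ - v`. [folklore] -/
theorem borel_cocycle (hadd : (∀ c₁ ∈ ((F) : Subfield k), ∀ c₂ ∈ (F), ((φ) : k → Matrix (Fin 3) (Fin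
    3) k) (c₁ + c₂) = (φ) c₁ + (!![(1 : k), (c₁), (c₁) ^ 2; 0, 1, 2 * (c₁); 0, 0, 1] : Matrix (Fin
    3) (Fin 3) k) * (φ) c₂ * (!![(1 : k), (-c₁), (-c₁) ^ 2; 0, 1, 2 * (-c₁); 0, 0, 1] : Matrix (Fin
    3) (Fin 3) k))) (hhom : (∀ d₁ ∈ ((F) : Subfield k), d₁ ≠ 0 → ∀ c₁ ∈ (F), ((φ) : k → Matrix (Fin
    3) (Fin 3) k) (d₁ ^ 2 * c₁) * diagonal ![d₁ ^ 4, d₁ ^ 2, 1] = diagonal ![d₁ ^ 4, d₁ ^ 2, 1] *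
    (φ) c₁))
    (h2 : (2 : k) ≠ 0) (h3 : (3 : k) ≠ 0) (h5 : (5 : k) ≠ 0) (h7 : (7 : k) ≠ 0) :
    ∃ v : Fin 3 → k, v 0 + v 1 + v 2 = 0 ∧
      ∀ c ∈ F, φ c = (!![(1 : k), (c), (c) ^ 2; 0, 1, 2 * (c); 0, 0, 1] : Matrix (Fin 3) (Fin 3)
          k) * diagonal v * (!![(1 : k), (-c), (-c) ^ 2; 0, 1, 2 * (-c); 0, 0, 1] : Matrix (Fin 3)
          (Fin 3) k) - diagonal v := by
  have h63 : (63 : k) ≠ 0 := by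
    rw [show (63 : k) = 3 * 3 * 7 by norm_num]
    simp [h3, h7]
  have h15 : (15 : k) ≠ 0 := by
    rw [show (15 : k) = 3 * 5 by norm_num]
    simp [h3, h5]
  have h6 : (6 : k) ≠ 0 := by
    rw [show (6 : k) = 2 * 3 by norm_num]
    simp [h2, h3]
  have h20 := borel_apply_two_zero hadd hhom h2 h63
  have h10 := borel_apply_one_zero hadd hhom h2 h15 h20
  have h21 := borel_apply_two_one hadd hhom h2 h15 h20
  have hdiag := borel_apply_diag hadd hhom h2 h3 h20 h10 h21
  have h01 := borel_apply_zero_one hadd hhom h2 h20 h10 h21 hdiag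
  have h12 := borel_apply_one_two hadd hhom h2 h20 h10 h21 hdiag
  have h02 := borel_apply_zero_two hadd hhom h2 h3 h20 h10 h21 hdiag h01 h12
  set α₁ := φ 1 0 1
  set β₁ := φ 1 1 2
  refine ⟨![-(4 * α₁ + β₁) / 6, (2 * α₁ - β₁) / 6, (α₁ + β₁) / 3], ?_, ?_⟩
  · simp only [Matrix.cons_val_zero, Matrix.cons_val_one, Matrix.cons_val_two, Matrix.head_cons,
      Matrix.tail_cons]
    field_simp
    ring
  · intro c hc
    obtain ⟨e00, e11, e22⟩ := hdiag c hc
    have e20 := h20 c hc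
    have e10 := h10 c hc
    have e21 := h21 c hc
    have e01 := h01 c hc
    have e12 := h12 c hc
    have e02 : φ c 0 2 = c ^ 2 * (β₁ - 2 * α₁) / 2 := by
      rw [eq_div_iff h2]
      linear_combination h02 c hc
    ext i j
    rw [Matrix.sub_apply, transl3_conj]
    fin_cases i <;> fin_cases j
    · simp [e00, Matrix.diagonal]
    · simp [e01, Matrix.diagonal, -mul_eq_mul_left_iff, -mul_eq_mul_right_iff]
      field_simp
      ring
    · simp [e02, Matrix.diagonal, -mul_eq_mul_left_iff, -mul_eq_mul_right_iff]
      field_simp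
      ring
    · simp [e10, Matrix.diagonal]
    · simp [e11, Matrix.diagonal]
    · simp [e12, Matrix.diagonal, -mul_eq_mul_left_iff, -mul_eq_mul_right_iff]
      field_simp
      ring
    · simp [e20, Matrix.diagonal]
    · simp [e21, Matrix.diagonal]
    · simp [e22, Matrix.diagonal]

end Borel


/-- `Sym²` is multiplicative on matrices of `GL₂`. [folklore] -/
theorem symSqMat_mul (a b : GL (Fin 2) k) : ((Matrix.GeneralLinearGroup.symSq ((a * b) : GL (Fin 2)
    k) : GL (Fin 3) k) : Matrix (Fin 3) (Fin 3) k) = ((Matrix.GeneralLinearGroup.symSq ((a) : GL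
    (Fin 2) k) : GL (Fin 3) k) : Matrix (Fin 3) (Fin 3) k) * ((Matrix.GeneralLinearGroup.symSq ((b)
    : GL (Fin 2) k) : GL (Fin 3) k) : Matrix (Fin 3) (Fin 3) k) := by
  rw [map_mul, Matrix.GeneralLinearGroup.coe_mul]

/-- `Sym²(a) Sym²(a⁻¹) = 1`. [folklore] -/
@[simp] theorem symSqMat_mul_inv (a : GL (Fin 2) k) : ((Matrix.GeneralLinearGroup.symSq ((a) : GL
    (Fin 2) k) : GL (Fin 3) k) : Matrix (Fin 3) (Fin 3) k) * ((Matrix.GeneralLinearGroup.symSq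
    ((a⁻¹) : GL (Fin 2) k) : GL (Fin 3) k) : Matrix (Fin 3) (Fin 3) k) = 1 := by
  rw [← symSqMat_mul, mul_inv_cancel, map_one, Matrix.GeneralLinearGroup.coe_one]

/-- `Sym²(a⁻¹) Sym²(a) = 1`. [folklore] -/
@[simp] theorem symSqMat_inv_mul (a : GL (Fin 2) k) : ((Matrix.GeneralLinearGroup.symSq ((a⁻¹) : GL
    (Fin 2) k) : GL (Fin 3) k) : Matrix (Fin 3) (Fin 3) k) * ((Matrix.GeneralLinearGroup.symSq ((a)
    : GL (Fin 2) k) : GL (Fin 3) k) : Matrix (Fin 3) (Fin 3) k) = 1 := by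
  rw [← symSqMat_mul, inv_mul_cancel, map_one, Matrix.GeneralLinearGroup.coe_one]

/-- `Sym²(1) = 1`. [folklore] -/
@[simp] theorem symSqMat_one : ((Matrix.GeneralLinearGroup.symSq (((1 : GL (Fin 2) k)) : GL (Fin 2)
    k) : GL (Fin 3) k) : Matrix (Fin 3) (Fin 3) k) = 1 := by
  rw [map_one, Matrix.GeneralLinearGroup.coe_one]

/-- `Sym²((ab)⁻¹) = Sym²(b⁻¹) Sym²(a⁻¹)`. [folklore] -/
theorem symSqMat_mul_inv_rev (a b : GL (Fin 2) k) : ((Matrix.GeneralLinearGroup.symSq (((a * b)⁻¹) :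
    GL (Fin 2) k) : GL (Fin 3) k) : Matrix (Fin 3) (Fin 3) k) = ((Matrix.GeneralLinearGroup.symSq
    ((b⁻¹) : GL (Fin 2) k) : GL (Fin 3) k) : Matrix (Fin 3) (Fin 3)
    k) * ((Matrix.GeneralLinearGroup.symSq ((a⁻¹) : GL (Fin 2) k) : GL (Fin 3) k) : Matrix (Fin 3)
    (Fin 3) k) := by
  rw [_root_.mul_inv_rev, symSqMat_mul]


section Averaging

/-- A cocycle vanishes at `1`. [folklore] -/
theorem cocycle_one {H : Subgroup (GL (Fin 2) k)} {f : GL (Fin 2) k → Matrix (Fin 3) (Fin 3) k}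
    (hf : (∀ a₁ ∈ ((H) : Subgroup (GL (Fin 2) k)), ∀ b₁ ∈ (H), ((f) : GL (Fin 2) k → Matrix (Fin 3)
        (Fin 3) k) (a₁ * b₁) = ((Matrix.GeneralLinearGroup.symSq ((a₁) : GL (Fin 2) k) : GL (Fin 3)
        k) : Matrix (Fin 3) (Fin 3) k) * (f) b₁ * ((Matrix.GeneralLinearGroup.symSq ((a₁⁻¹) : GL
        (Fin 2) k) : GL (Fin 3) k) : Matrix (Fin 3) (Fin 3) k) + (f) a₁)) : f 1 = 0 := by
  have h := hf 1 H.one_mem 1 H.one_mem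
  rw [mul_one, inv_one, symSqMat_one, one_mul, mul_one] at h
  have h' : f 1 + f 1 = f 1 + 0 := by rw [add_zero]; exact h.symm
  exact add_left_cancel h'

/-- Restricting a cocycle to a smaller subgroup. [folklore] -/
theorem cocycleOn_of_le {H K : Subgroup (GL (Fin 2) k)} (hKH : K ≤ H) {f : GL (Fin 2) k → Matrix
    (Fin 3) (Fin 3) k}
    (hf : (∀ a₁ ∈ ((H) : Subgroup (GL (Fin 2) k)), ∀ b₁ ∈ (H), ((f) : GL (Fin 2) k → Matrix (Fin 3)
        (Fin 3) k) (a₁ * b₁) = ((Matrix.GeneralLinearGroup.symSq ((a₁) : GL (Fin 2) k) : GL (Fin 3)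
        k) : Matrix (Fin 3) (Fin 3) k) * (f) b₁ * ((Matrix.GeneralLinearGroup.symSq ((a₁⁻¹) : GL
        (Fin 2) k) : GL (Fin 3) k) : Matrix (Fin 3) (Fin 3) k) + (f) a₁)) : (∀ a₁ ∈ ((K) : Subgroup
        (GL (Fin 2) k)), ∀ b₁ ∈ (K), ((f) : GL (Fin 2) k → Matrix (Fin 3) (Fin 3) k) (a₁ * b₁) =
        ((Matrix.GeneralLinearGroup.symSq ((a₁) : GL (Fin 2) k) : GL (Fin 3) k) : Matrix (Fin 3)
        (Fin 3) k) * (f) b₁ * ((Matrix.GeneralLinearGroup.symSq ((a₁⁻¹) : GL (Fin 2) k) : GL (Fin 3)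
        k) : Matrix (Fin 3) (Fin 3) k) + (f) a₁) :=
  fun a ha b hb => hf a (hKH ha) b (hKH hb)

/-- Subtracting a coboundary from a cocycle gives a cocycle. [folklore] -/
theorem cocycle_sub_coboundary {H : Subgroup (GL (Fin 2) k)} {f : GL (Fin 2) k → Matrix (Fin 3) (Fin
    3) k}
    (hf : (∀ a₁ ∈ ((H) : Subgroup (GL (Fin 2) k)), ∀ b₁ ∈ (H), ((f) : GL (Fin 2) k → Matrix (Fin 3)
        (Fin 3) k) (a₁ * b₁) = ((Matrix.GeneralLinearGroup.symSq ((a₁) : GL (Fin 2) k) : GL (Fin 3)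
        k) : Matrix (Fin 3) (Fin 3) k) * (f) b₁ * ((Matrix.GeneralLinearGroup.symSq ((a₁⁻¹) : GL
        (Fin 2) k) : GL (Fin 3) k) : Matrix (Fin 3) (Fin 3) k) + (f) a₁)) (m : Matrix (Fin 3) (Fin
        3) k) :
    (∀ a₁ ∈ ((H) : Subgroup (GL (Fin 2) k)), ∀ b₁ ∈ (H), ((fun a => f a -
        (((Matrix.GeneralLinearGroup.symSq ((a) : GL (Fin 2) k) : GL (Fin 3) k) : Matrix (Fin 3)
        (Fin 3) k) * m * ((Matrix.GeneralLinearGroup.symSq ((a⁻¹) : GL (Fin 2) k) : GL (Fin 3) k) :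
        Matrix (Fin 3) (Fin 3) k) - m)) : GL (Fin 2) k → Matrix (Fin 3) (Fin 3) k) (a₁ * b₁) =
        ((Matrix.GeneralLinearGroup.symSq ((a₁) : GL (Fin 2) k) : GL (Fin 3) k) : Matrix (Fin 3)
        (Fin 3) k) * (fun a => f a - (((Matrix.GeneralLinearGroup.symSq ((a) : GL (Fin 2) k) : GL
        (Fin 3) k) : Matrix (Fin 3) (Fin 3) k) * m * ((Matrix.GeneralLinearGroup.symSq ((a⁻¹) : GL
        (Fin 2) k) : GL (Fin 3) k) : Matrix (Fin 3) (Fin 3) k) - m)) b₁ *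
        ((Matrix.GeneralLinearGroup.symSq ((a₁⁻¹) : GL (Fin 2) k) : GL (Fin 3) k) : Matrix (Fin 3)
        (Fin 3) k) + (fun a => f a - (((Matrix.GeneralLinearGroup.symSq ((a) : GL (Fin 2) k) : GL
        (Fin 3) k) : Matrix (Fin 3) (Fin 3) k) * m * ((Matrix.GeneralLinearGroup.symSq ((a⁻¹) : GL
        (Fin 2) k) : GL (Fin 3) k) : Matrix (Fin 3) (Fin 3) k) - m)) a₁) := by
  intro a ha b hb
  simp only
  rw [hf a ha b hb, symSqMat_mul_inv_rev, symSqMat_mul]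
  have h1 : ((Matrix.GeneralLinearGroup.symSq ((a) : GL (Fin 2) k) : GL (Fin 3) k) : Matrix (Fin 3)
      (Fin 3) k) * (f b - (((Matrix.GeneralLinearGroup.symSq ((b) : GL (Fin 2) k) : GL (Fin 3) k) :
      Matrix (Fin 3) (Fin 3) k) * m * ((Matrix.GeneralLinearGroup.symSq ((b⁻¹) : GL (Fin 2) k) : GL
      (Fin 3) k) : Matrix (Fin 3) (Fin 3) k) - m)) * ((Matrix.GeneralLinearGroup.symSq ((a⁻¹) : GL
      (Fin 2) k) : GL (Fin 3) k) : Matrix (Fin 3) (Fin 3) k) =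
      ((Matrix.GeneralLinearGroup.symSq ((a) : GL (Fin 2) k) : GL (Fin 3) k) : Matrix (Fin 3) (Fin
          3) k) * f b * ((Matrix.GeneralLinearGroup.symSq ((a⁻¹) : GL (Fin 2) k) : GL (Fin 3) k) :
          Matrix (Fin 3) (Fin 3) k) - (((Matrix.GeneralLinearGroup.symSq ((a) : GL (Fin 2) k) : GL
          (Fin 3) k) : Matrix (Fin 3) (Fin 3) k) * ((Matrix.GeneralLinearGroup.symSq ((b) : GL (Fin
          2) k) : GL (Fin 3) k) : Matrix (Fin 3) (Fin 3) k) * m * (((Matrix.GeneralLinearGroup.symSq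
          ((b⁻¹) : GL (Fin 2) k) : GL (Fin 3) k) : Matrix (Fin 3) (Fin 3) k) *
          ((Matrix.GeneralLinearGroup.symSq ((a⁻¹) : GL (Fin 2) k) : GL (Fin 3) k) : Matrix (Fin 3)
          (Fin 3) k)) - ((Matrix.GeneralLinearGroup.symSq ((a) : GL (Fin 2) k) : GL (Fin 3) k) :
          Matrix (Fin 3) (Fin 3) k) * m * ((Matrix.GeneralLinearGroup.symSq ((a⁻¹) : GL (Fin 2) k) :
          GL (Fin 3) k) : Matrix (Fin 3) (Fin 3) k)) := by
    noncomm_ring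
  rw [h1]
  abel

/-- **Averaging over a subgroup of invertible order**: a `1`-cocycle on a finite subgroup
`K ≤ GL₂(k)` whose order is invertible in `k` is a coboundary (`H¹(K, V) = 0` for `|K| ∈ kˣ`),
with `m = -|K|⁻¹ ∑_{x ∈ K} f(x)`. [folklore] -/
theorem exists_coboundary_of_card (K : Subgroup (GL (Fin 2) k)) [Finite K]
    (hK : ((Nat.card K : ℕ) : k) ≠ 0) {f : GL (Fin 2) k → Matrix (Fin 3) (Fin 3) k} (hf : (∀ a₁ ∈
        ((K) : Subgroup (GL (Fin 2) k)), ∀ b₁ ∈ (K), ((f) : GL (Fin 2) k → Matrix (Fin 3) (Fin 3) k)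
        (a₁ * b₁) = ((Matrix.GeneralLinearGroup.symSq ((a₁) : GL (Fin 2) k) : GL (Fin 3) k) : Matrix
        (Fin 3) (Fin 3) k) * (f) b₁ * ((Matrix.GeneralLinearGroup.symSq ((a₁⁻¹) : GL (Fin 2) k) : GL
        (Fin 3) k) : Matrix (Fin 3) (Fin 3) k) + (f) a₁)) :
    ∃ m : Matrix (Fin 3) (Fin 3) k, ∀ a ∈ K, f a = ((Matrix.GeneralLinearGroup.symSq ((a) : GL (Fin
        2) k) : GL (Fin 3) k) : Matrix (Fin 3) (Fin 3) k) * m * ((Matrix.GeneralLinearGroup.symSq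
        ((a⁻¹) : GL (Fin 2) k) : GL (Fin 3) k) : Matrix (Fin 3) (Fin 3) k) - m := by
  classical
  haveI : Fintype K := Fintype.ofFinite K
  set N : k := ((Nat.card K : ℕ) : k) with hN
  refine ⟨-(N⁻¹ • ∑ x : K, f (x : GL (Fin 2) k)), fun a ha => ?_⟩
  -- reindex the sum `∑ f(a x) = ∑ f(x)`
  have hre : ∑ x : K, f (a * (x : GL (Fin 2) k)) = ∑ x : K, f (x : GL (Fin 2) k) :=
    Fintype.sum_bijective (fun x : K => (⟨a, ha⟩ : K) * x) (Group.mulLeft_bijective _) _ _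
      (fun _ => rfl)
  have hsum : ∑ x : K, ((Matrix.GeneralLinearGroup.symSq ((a) : GL (Fin 2) k) : GL (Fin 3) k) :
      Matrix (Fin 3) (Fin 3) k) * f (x : GL (Fin 2) k) * ((Matrix.GeneralLinearGroup.symSq ((a⁻¹) :
      GL (Fin 2) k) : GL (Fin 3) k) : Matrix (Fin 3) (Fin 3) k) =
      (∑ x : K, f (x : GL (Fin 2) k)) - N • f a := by
    have : ∀ x : K, ((Matrix.GeneralLinearGroup.symSq ((a) : GL (Fin 2) k) : GL (Fin 3) k) : Matrix
        (Fin 3) (Fin 3) k) * f (x : GL (Fin 2) k) * ((Matrix.GeneralLinearGroup.symSq ((a⁻¹) : GL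
        (Fin 2) k) : GL (Fin 3) k) : Matrix (Fin 3) (Fin 3) k) = f (a * x) - f a := by
      intro x
      rw [hf a ha x x.2, add_sub_cancel_right]
    simp_rw [this, Finset.sum_sub_distrib, hre, Finset.sum_const, Finset.card_univ, hN,
      Nat.card_eq_fintype_card, Nat.cast_smul_eq_nsmul]
  rw [Matrix.mul_neg, Matrix.neg_mul, Matrix.mul_smul, Matrix.smul_mul, Finset.mul_sum,
    Finset.sum_mul, hsum, smul_sub, sub_neg_eq_add, smul_smul, inv_mul_cancel₀ hK, one_smul]
  abel

end Averaging


section Restriction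

/-- **Restriction to a subgroup of invertible index is injective on `H¹`**: if a `1`-cocycle
`f` on a finite `H ≤ GL₂(k)` restricts to a coboundary on a subgroup `B ≤ H` whose index is
invertible in `k`, then `f` is a coboundary on `H` (average the `B`-normalised cocycle over
`H/B`). [folklore] -/
theorem exists_coboundary_of_relIndex (H B : Subgroup (GL (Fin 2) k)) [Finite H] (hBH : B ≤ H)
    (hidx : ((B.relIndex H : ℕ) : k) ≠ 0) {f : GL (Fin 2) k → Matrix (Fin 3) (Fin 3) k} (hf : (∀ a₁
        ∈ ((H) : Subgroup (GL (Fin 2) k)), ∀ b₁ ∈ (H), ((f) : GL (Fin 2) k → Matrix (Fin 3) (Fin 3)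
        k) (a₁ * b₁) = ((Matrix.GeneralLinearGroup.symSq ((a₁) : GL (Fin 2) k) : GL (Fin 3) k) :
        Matrix (Fin 3) (Fin 3) k) * (f) b₁ * ((Matrix.GeneralLinearGroup.symSq ((a₁⁻¹) : GL (Fin 2)
        k) : GL (Fin 3) k) : Matrix (Fin 3) (Fin 3) k) + (f) a₁))
    {m : Matrix (Fin 3) (Fin 3) k} (hm : ∀ b ∈ B, f b = ((Matrix.GeneralLinearGroup.symSq ((b) : GL
        (Fin 2) k) : GL (Fin 3) k) : Matrix (Fin 3) (Fin 3) k) * m *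
        ((Matrix.GeneralLinearGroup.symSq ((b⁻¹) : GL (Fin 2) k) : GL (Fin 3) k) : Matrix (Fin 3)
        (Fin 3) k) - m) :
    ∃ m' : Matrix (Fin 3) (Fin 3) k, ∀ a ∈ H, f a = ((Matrix.GeneralLinearGroup.symSq ((a) : GL (Fin
        2) k) : GL (Fin 3) k) : Matrix (Fin 3) (Fin 3) k) * m' * ((Matrix.GeneralLinearGroup.symSq
        ((a⁻¹) : GL (Fin 2) k) : GL (Fin 3) k) : Matrix (Fin 3) (Fin 3) k) - m' := by
  classical
  -- the normalised cocycle `f'` vanishes on `B`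
  set f' : GL (Fin 2) k → Matrix (Fin 3) (Fin
      3) k := fun a => f a - (((Matrix.GeneralLinearGroup.symSq ((a) : GL (Fin 2) k) : GL (Fin 3) k)
      : Matrix (Fin 3) (Fin 3) k) * m * ((Matrix.GeneralLinearGroup.symSq ((a⁻¹) : GL (Fin 2) k) :
      GL (Fin 3) k) : Matrix (Fin 3) (Fin 3) k) - m) with hf'def
  have hf' : (∀ a₁ ∈ ((H) : Subgroup (GL (Fin 2) k)), ∀ b₁ ∈ (H), ((f') : GL (Fin 2) k → Matrix (Fin
      3) (Fin 3) k) (a₁ * b₁) = ((Matrix.GeneralLinearGroup.symSq ((a₁) : GL (Fin 2) k) : GL (Fin 3)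
      k) : Matrix (Fin 3) (Fin 3) k) * (f') b₁ * ((Matrix.GeneralLinearGroup.symSq ((a₁⁻¹) : GL (Fin
      2) k) : GL (Fin 3) k) : Matrix (Fin 3) (Fin 3) k) + (f') a₁) := cocycle_sub_coboundary hf m
  have hB0 : ∀ b ∈ B, f' b = 0 := fun b hb => by simp only [hf'def, hm b hb, sub_self]
  -- `f'` is constant on the left cosets of `B`
  have hconst : ∀ a ∈ H, ∀ b ∈ B, f' (a * b) = f' a := by
    intro a ha b hb
    rw [hf' a ha b (hBH hb), hB0 b hb, Matrix.mul_zero, Matrix.zero_mul, zero_add]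
  -- pass to the quotient `H / B`
  set B' : Subgroup H := B.subgroupOf H with hB'
  haveI : Fintype H := Fintype.ofFinite H
  haveI : Fintype (H ⧸ B') := Fintype.ofFinite _
  letI : MulAction H (H ⧸ B') := MulAction.quotient H B'
  set Fq : H ⧸ B' → Matrix (Fin 3) (Fin 3) k := fun q => f' ((q.out : H) : GL (Fin 2) k) with hFqdef
  have hFq : ∀ x : H, Fq (x : H ⧸ B') = f' x := by
    intro x
    obtain ⟨b, hb⟩ := QuotientGroup.mk_out_eq_mul B' x
    rw [hFqdef]
    dsimp only
    rw [hb, Subgroup.coe_mul]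
    exact hconst x x.2 _ (Subgroup.mem_subgroupOf.mp b.2)
  set N : k := ((B.relIndex H : ℕ) : k) with hN
  have hcardQ : (Finset.univ : Finset (H ⧸ B')).card = B.relIndex H := by
    rw [Finset.card_univ, ← Nat.card_eq_fintype_card]
    rfl
  refine ⟨m - N⁻¹ • ∑ q : H ⧸ B', Fq q, fun a ha => ?_⟩
  have hre : ∑ q : H ⧸ B', Fq ((⟨a, ha⟩ : H) • q) = ∑ q : H ⧸ B', Fq q :=
    Fintype.sum_bijective _ (MulAction.bijective (⟨a, ha⟩ : H)) _ _ (fun _ => rfl)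
  have hsum : ∑ q : H ⧸ B', ((Matrix.GeneralLinearGroup.symSq ((a) : GL (Fin 2) k) : GL (Fin 3) k) :
      Matrix (Fin 3) (Fin 3) k) * Fq q * ((Matrix.GeneralLinearGroup.symSq ((a⁻¹) : GL (Fin 2) k) :
      GL (Fin 3) k) : Matrix (Fin 3) (Fin 3) k) = (∑ q : H ⧸ B', Fq q) - N • f' a := by
    have : ∀ q : H ⧸ B', ((Matrix.GeneralLinearGroup.symSq ((a) : GL (Fin 2) k) : GL (Fin 3) k) :
        Matrix (Fin 3) (Fin 3) k) * Fq q * ((Matrix.GeneralLinearGroup.symSq ((a⁻¹) : GL (Fin 2) k)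
        : GL (Fin 3) k) : Matrix (Fin 3) (Fin 3) k) = Fq ((⟨a, ha⟩ : H) • q) - f' a := by
      intro q
      induction q using QuotientGroup.induction_on with
      | H x =>
        rw [hFq x, MulAction.Quotient.smul_mk, smul_eq_mul, hFq, Subgroup.coe_mul,
          hf' a ha x x.2, add_sub_cancel_right]
    simp_rw [this, Finset.sum_sub_distrib, hre, Finset.sum_const, hcardQ, hN,
      Nat.cast_smul_eq_nsmul]
  have key : f' a = ((Matrix.GeneralLinearGroup.symSq ((a) : GL (Fin 2) k) : GL (Fin 3) k) : Matrix
      (Fin 3) (Fin 3) k) * (-(N⁻¹ • ∑ q : H ⧸ B', Fq q)) * ((Matrix.GeneralLinearGroup.symSq ((a⁻¹)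
      : GL (Fin 2) k) : GL (Fin 3) k) : Matrix (Fin 3) (Fin 3) k)
      - (-(N⁻¹ • ∑ q : H ⧸ B', Fq q)) := by
    rw [Matrix.mul_neg, Matrix.neg_mul, Matrix.mul_smul, Matrix.smul_mul, Finset.mul_sum,
      Finset.sum_mul, hsum, smul_sub, smul_smul, inv_mul_cancel₀ hidx, one_smul]
    abel
  have hfa : f a = f' a + (((Matrix.GeneralLinearGroup.symSq ((a) : GL (Fin 2) k) : GL (Fin 3) k) :
      Matrix (Fin 3) (Fin 3) k) * m * ((Matrix.GeneralLinearGroup.symSq ((a⁻¹) : GL (Fin 2) k) : GL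
      (Fin 3) k) : Matrix (Fin 3) (Fin 3) k) - m) := by simp only [hf'def, sub_add_cancel]
  rw [hfa, key]
  simp only [Matrix.mul_sub, Matrix.sub_mul, Matrix.mul_neg, Matrix.neg_mul]
  abel

end Restriction


/-! ### Subgroups of `GL₂(k)` in normal form

Let `H ≤ GL₂(k)` be a finite subgroup and `F ≤ k` a subfield such that `H` contains the
translations `(1 c; 0 1)`, `c ∈ F`, contains a scalar multiple of `diag(d, d⁻¹)` for every
`d ∈ Fˣ`, and consists of scalar multiples of `F`-rational matrices (this is the normal form of a
finite `H` whose image in `PGL₂(k)` lies between `PSL₂(F)` and `PGL₂(F)`).  We record the Borel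
decomposition `b = (1 c; 0 1) · diag` of its upper triangular elements and deduce, from the Borel
cocycle lemma together with the averaging and restriction lemmas, that `H¹(H, Matrix (Fin 3) (Fin 3)
    k(k)) = 0` for the
action `Ad ∘ Sym²`, and that `H` has no non-trivial `l`-group quotient, as soon as the diagonal
part of `H` has order prime to `l = char k` and the upper triangular part has index prime to `l`. -/

section NormalForm

/-- An upper triangular element of `GL₂` has non-zero diagonal entries. [folklore] -/
theorem apply_one_one_ne_zero {g : GL (Fin 2) k} (hg : (g : Matrix (Fin 2) (Fin 2) k) 1 0 = 0) :
    (g : Matrix (Fin 2) (Fin 2) k) 1 1 ≠ 0 ∧ (g : Matrix (Fin 2) (Fin 2) k) 0 0 ≠ 0 := by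
  have hdet : (g : Matrix (Fin 2) (Fin 2) k).det ≠ 0 := by
    rw [← Matrix.GeneralLinearGroup.val_det_apply]
    exact g.det.ne_zero
  rw [Matrix.det_fin_two, hg, mul_zero, sub_zero] at hdet
  exact ⟨right_ne_zero_of_mul hdet, left_ne_zero_of_mul hdet⟩

/-- The matrix of the translation `(1 c; 0 1)`. [folklore] -/
theorem coe_upperRightHom (c : k) :
    ((Matrix.GeneralLinearGroup.upperRightHom c : GL (Fin 2) k) : Matrix (Fin 2) (Fin 2) k) = !![1,
        c; 0, 1] := rfl

/-- `Sym²` of a translation. [folklore] -/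
theorem symSqMat_upperRightHom (c : k) :
    ((Matrix.GeneralLinearGroup.symSq ((Matrix.GeneralLinearGroup.upperRightHom c) : GL (Fin 2) k) :
        GL (Fin 3) k) : Matrix (Fin 3) (Fin 3) k) = (!![(1 : k), (c), (c) ^ 2; 0, 1, 2 * (c); 0, 0,
        1] : Matrix (Fin 3) (Fin 3) k) := by
  rw [Matrix.GeneralLinearGroup.coe_symSq, coe_upperRightHom, symSq_transl]

/-- `Sym²` of the inverse of a translation. [folklore] -/
theorem symSqMat_upperRightHom_inv (c : k) :
    ((Matrix.GeneralLinearGroup.symSq (((Matrix.GeneralLinearGroup.upperRightHom c)⁻¹) : GL (Fin 2)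
        k) : GL (Fin 3) k) : Matrix (Fin 3) (Fin 3) k) = (!![(1 : k), (-c), (-c) ^ 2; 0, 1, 2 *
        (-c); 0, 0, 1] : Matrix (Fin 3) (Fin 3) k) := by
  rw [← AddChar.map_neg_eq_inv, symSqMat_upperRightHom]

/-- `Sym²` of a diagonal element of `GL₂` is diagonal: `Sym² diag(a, e) = diag(a², ae, e²)`.
[folklore] -/
theorem symSqMat_of_diag {g : GL (Fin 2) k} (h10 : (g : Matrix (Fin 2) (Fin 2) k) 1 0 = 0) (h01 : (g
    : Matrix (Fin 2) (Fin 2) k) 0 1 = 0) :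
    ((Matrix.GeneralLinearGroup.symSq ((g) : GL (Fin 2) k) : GL (Fin 3) k) : Matrix (Fin 3) (Fin 3)
        k) = diagonal ![(g : Matrix (Fin 2) (Fin 2) k) 0 0 ^ 2, (g : Matrix (Fin 2) (Fin 2) k) 0 0 *
        (g : Matrix (Fin 2) (Fin 2) k) 1 1, (g : Matrix (Fin 2) (Fin 2) k) 1 1 ^ 2] := by
  rw [Matrix.GeneralLinearGroup.coe_symSq]
  ext i j
  fin_cases i <;> fin_cases j <;>
    simp [Literature.NumberTheory.EllipticCurves.TernaryPairs.symSq, h10, h01, Matrix.diagonal]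

/-- A diagonal element `h = diag(a, e)` with `a = s e` conjugates the translation by `c` to the
translation by `s c`: `h (1 c; 0 1) = (1 sc; 0 1) h`. [folklore] -/
theorem diag_mul_upperRightHom {h : GL (Fin 2) k} {s : k} (h10 : (h : Matrix (Fin 2) (Fin 2) k) 1 0
    = 0)
    (h01 : (h : Matrix (Fin 2) (Fin 2) k) 0 1 = 0) (h00 : (h : Matrix (Fin 2) (Fin 2) k) 0 0 = s *
        (h : Matrix (Fin 2) (Fin 2) k) 1 1) (c : k) :
    h * Matrix.GeneralLinearGroup.upperRightHom c =
      Matrix.GeneralLinearGroup.upperRightHom (s * c) * h := by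
  apply Units.ext
  rw [Matrix.GeneralLinearGroup.coe_mul, Matrix.GeneralLinearGroup.coe_mul, coe_upperRightHom,
    coe_upperRightHom]
  ext i j
  fin_cases i <;> fin_cases j <;> simp [Matrix.mul_apply, Fin.sum_univ_two, h10, h01, h00]
  ring

variable [DecidableEq k]



/-- Membership in the Borel subgroup: `g ∈ B ↔ g₁₀ = 0`. [folklore] -/
theorem mem_borel_iff {g : GL (Fin 2) k} : g ∈ MulAction.stabilizer (GL (Fin 2) k) (∞ : OnePoint
    k) ↔ (g : Matrix (Fin 2) (Fin 2) k) 1 0 = 0 :=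
  MulAction.mem_stabilizer_iff.trans OnePoint.smul_infty_eq_self_iff

/-- Membership in the diagonal subgroup: `g ∈ D ↔ g₁₀ = 0 ∧ g₀₁ = 0`. [folklore] -/
theorem mem_diag_iff {g : GL (Fin 2) k} : g ∈ (MulAction.stabilizer (GL (Fin 2) k) (∞ : OnePoint k)
    ⊓ MulAction.stabilizer (GL (Fin 2) k) (((0 : k)) : OnePoint k)) ↔ (g : Matrix (Fin 2) (Fin 2)
    k) 1 0 = 0 ∧ (g : Matrix (Fin 2) (Fin 2) k) 0 1 = 0 := by
  rw [Subgroup.mem_inf, mem_borel_iff, MulAction.mem_stabilizer_iff]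
  constructor
  · rintro ⟨h10, h0⟩
    refine ⟨h10, ?_⟩
    have h11 := (apply_one_one_ne_zero h10).1
    rw [OnePoint.smul_some_eq_ite] at h0
    simp only [mul_zero, zero_add] at h0
    rw [if_neg h11, OnePoint.coe_eq_coe, div_eq_zero_iff] at h0
    exact h0.resolve_right h11
  · rintro ⟨h10, h01⟩
    refine ⟨h10, ?_⟩
    have h11 := (apply_one_one_ne_zero h10).1
    rw [OnePoint.smul_some_eq_ite]
    simp only [mul_zero, zero_add]
    rw [if_neg h11, h01, zero_div]

variable {H : Subgroup (GL (Fin 2) k)} {F : Subfield k}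




omit [DecidableEq k] in
/-- **Borel decomposition**: an upper triangular element of `H` is `(1 c; 0 1) · d` with `c ∈ F`
and `d ∈ H` diagonal. [folklore] -/
theorem exists_borel_decomp (hU : (∀ c₁ ∈ ((F) : Subfield k),
    Matrix.GeneralLinearGroup.upperRightHom c₁ ∈ ((H) : Subgroup (GL (Fin 2) k)))) (hF : (∀ h₁ ∈
    ((H) : Subgroup (GL (Fin 2) k)), ∃ s₁ : k, s₁ ≠ 0 ∧ ∀ i j, s₁ * (h₁ : Matrix (Fin 2) (Fin 2) k)
    i j ∈ ((F) : Subfield k))) {b : GL (Fin 2) k}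
    (hb : b ∈ H) (hb10 : (b : Matrix (Fin 2) (Fin 2) k) 1 0 = 0) :
    ∃ c ∈ F, ∃ d ∈ H, (d : Matrix (Fin 2) (Fin 2) k) 1 0 = 0 ∧ (d : Matrix (Fin 2) (Fin 2)
        k) 0 1 = 0 ∧
      b = Matrix.GeneralLinearGroup.upperRightHom c * d := by
  obtain ⟨s, hs, hsF⟩ := hF b hb
  have h11 := (apply_one_one_ne_zero hb10).1
  set c : k := (b : Matrix (Fin 2) (Fin 2) k) 0 1 / (b : Matrix (Fin 2) (Fin 2) k) 1 1 with hc
  have hcF : c ∈ F := by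
    have : c = (s * (b : Matrix (Fin 2) (Fin 2) k) 0 1) / (s * (b : Matrix (Fin 2) (Fin 2) k) 1
        1) := by
      rw [hc, mul_div_mul_left _ _ hs]
    rw [this]
    exact F.div_mem (hsF 0 1) (hsF 1 1)
  refine ⟨c, hcF, (Matrix.GeneralLinearGroup.upperRightHom c)⁻¹ * b,
    H.mul_mem (H.inv_mem (hU c hcF)) hb, ?_, ?_, by rw [mul_inv_cancel_left]⟩
  · rw [← AddChar.map_neg_eq_inv, Matrix.GeneralLinearGroup.coe_mul, coe_upperRightHom]
    simp [Matrix.mul_apply, Fin.sum_univ_two, hb10]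
  · rw [← AddChar.map_neg_eq_inv, Matrix.GeneralLinearGroup.coe_mul, coe_upperRightHom]
    simp [Matrix.mul_apply, Fin.sum_univ_two, hc]
    field_simp
    ring

omit [DecidableEq k] in
/-- **A finite group of diagonal matrices over a field of characteristic `l` has order prime
to `l`**: an element of order `l` would be a diagonal matrix `diag(a, e)` with `aˡ = eˡ = 1`,
hence `a = e = 1` by the injectivity of Frobenius. [folklore] -/
theorem not_dvd_card_of_diag (l : ℕ) [Fact l.Prime] [CharP k l] (K : Subgroup (GL (Fin 2) k))
    [Finite K] (hK : ∀ g ∈ K, (g : Matrix (Fin 2) (Fin 2) k) 1 0 = 0 ∧ (g : Matrix (Fin 2) (Fin 2)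
        k) 0 1 = 0) : ¬ l ∣ Nat.card K := by
  intro hdvd
  obtain ⟨x, hx⟩ := exists_prime_orderOf_dvd_card' l hdvd
  have hxl : ((x : GL (Fin 2) k) : Matrix (Fin 2) (Fin 2) k) ^ l = 1 := by
    rw [← Units.val_pow_eq_pow_val, ← Subgroup.coe_pow, ← hx, pow_orderOf_eq_one,
      Subgroup.coe_one, Matrix.GeneralLinearGroup.coe_one]
  obtain ⟨h10, h01⟩ := hK x x.2
  have hdiag : ((x : GL (Fin 2) k) : Matrix (Fin 2) (Fin 2) k) =
      diagonal ![((x : GL (Fin 2) k) : Matrix (Fin 2) (Fin 2) k) 0 0, ((x : GL (Fin 2) k) : Matrix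
          (Fin 2) (Fin 2) k) 1 1] := by
    ext i j
    fin_cases i <;> fin_cases j <;> simp [h10, h01, Matrix.diagonal]
  rw [hdiag, Matrix.diagonal_pow] at hxl
  have h0 := congrFun (congrFun hxl 0) 0
  have h1 := congrFun (congrFun hxl 1) 1
  simp [Matrix.diagonal] at h0 h1
  have hinj := frobenius_inj k l
  have e0 : ((x : GL (Fin 2) k) : Matrix (Fin 2) (Fin 2) k) 0 0 = 1 := hinj (by rw [frobenius_def,
      frobenius_def, one_pow, h0])
  have e1 : ((x : GL (Fin 2) k) : Matrix (Fin 2) (Fin 2) k) 1 1 = 1 := hinj (by rw [frobenius_def,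
      frobenius_def, one_pow, h1])
  have hx1 : x = 1 := by
    apply Subtype.ext
    apply Units.ext
    rw [hdiag, e0, e1, Subgroup.coe_one, Matrix.GeneralLinearGroup.coe_one]
    ext i j
    fin_cases i <;> fin_cases j <;> simp [Matrix.diagonal]
  rw [hx1, orderOf_one] at hx
  exact (Fact.out : l.Prime).one_lt.ne hx


/-- **`H¹ = 0` for a subgroup in normal form.**  Let `H ≤ GL₂(k)` be finite, containing the
translations by the subfield `F` and a scalar multiple of `diag(d, d⁻¹)` for each `d ∈ Fˣ`, and
consisting of scalar multiples of `F`-rational matrices; assume `char k ∉ {2, 3, 5, 7}`, that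
the diagonal part of `H` has order invertible in `k` and that the upper triangular part of `H`
has index invertible in `k`.  Then every `1`-cocycle of `H` with values in `Matrix (Fin 3) (Fin
    3) k(k)` (action
`Ad ∘ Sym²`) is a coboundary.  Proof: average over the diagonal part (order prime to `l`),
apply the Borel cocycle lemma to the translations, extend to the Borel subgroup by the Borel
decomposition, and conclude by the injectivity of restriction to a subgroup of index prime to
`l`. [folklore] -/
theorem exists_coboundary_of_normalForm (h2 : (2 : k) ≠ 0) (h3 : (3 : k) ≠ 0) (h5 : (5 : k) ≠ 0)
    (h7 : (7 : k) ≠ 0) (H : Subgroup (GL (Fin 2) k)) [Finite H] (F : Subfield k)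
    (hU : (∀ c₁ ∈ ((F) : Subfield k), Matrix.GeneralLinearGroup.upperRightHom c₁ ∈ ((H) : Subgroup
        (GL (Fin 2) k)))) (hT : (∀ d₁ ∈ ((F) : Subfield k), d₁ ≠ 0 → ∃ h₁ ∈ ((H) : Subgroup (GL (Fin
        2) k)), (h₁ : Matrix (Fin 2) (Fin 2) k) 1 0 = 0 ∧ (h₁ : Matrix (Fin 2) (Fin 2) k) 0 1 = 0 ∧
        (h₁ : Matrix (Fin 2) (Fin 2) k) 0 0 = d₁ ^ 2 * (h₁ : Matrix (Fin 2) (Fin 2) k) 1 1)) (hF :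
        (∀ h₁ ∈ ((H) : Subgroup (GL (Fin 2) k)), ∃ s₁ : k, s₁ ≠ 0 ∧ ∀ i j, s₁ * (h₁ : Matrix (Fin 2)
        (Fin 2) k) i j ∈ ((F) : Subfield k)))
    (hD : ((Nat.card (H ⊓ (MulAction.stabilizer (GL (Fin 2) k) (∞ : OnePoint k) ⊓
        MulAction.stabilizer (GL (Fin 2) k) (((0 : k)) : OnePoint k)) : Subgroup (GL (Fin 2) k)) :
        ℕ) : k) ≠ 0)
    (hidx : (((H ⊓ MulAction.stabilizer (GL (Fin 2) k) (∞ : OnePoint k)).relIndex H : ℕ) : k) ≠ 0)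
    {f : GL (Fin 2) k → Matrix (Fin 3) (Fin 3) k} (hf : (∀ a₁ ∈ ((H) : Subgroup (GL (Fin 2) k)), ∀
        b₁ ∈ (H), ((f) : GL (Fin 2) k → Matrix (Fin 3) (Fin 3) k) (a₁ * b₁) =
        ((Matrix.GeneralLinearGroup.symSq ((a₁) : GL (Fin 2) k) : GL (Fin 3) k) : Matrix (Fin 3)
        (Fin 3) k) * (f) b₁ * ((Matrix.GeneralLinearGroup.symSq ((a₁⁻¹) : GL (Fin 2) k) : GL (Fin 3)
        k) : Matrix (Fin 3) (Fin 3) k) + (f) a₁)) :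
    ∃ m : Matrix (Fin 3) (Fin 3) k, ∀ a ∈ H, f a = ((Matrix.GeneralLinearGroup.symSq ((a) : GL (Fin
        2) k) : GL (Fin 3) k) : Matrix (Fin 3) (Fin 3) k) * m * ((Matrix.GeneralLinearGroup.symSq
        ((a⁻¹) : GL (Fin 2) k) : GL (Fin 3) k) : Matrix (Fin 3) (Fin 3) k) - m := by
  -- Step 1: average over the diagonal part `D` of `H`
  haveI : Finite (H ⊓ (MulAction.stabilizer (GL (Fin 2) k) (∞ : OnePoint k) ⊓ MulAction.stabilizer
      (GL (Fin 2) k) (((0 : k)) : OnePoint k)) : Subgroup (GL (Fin 2) k)) :=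
    Finite.of_injective _ (Subgroup.inclusion_injective (inf_le_left : H ⊓ (MulAction.stabilizer (GL
        (Fin 2) k) (∞ : OnePoint k) ⊓ MulAction.stabilizer (GL (Fin 2) k) (((0 : k)) : OnePoint k))
        ≤ H))
  obtain ⟨m₀, hm₀⟩ := exists_coboundary_of_card (H ⊓ (MulAction.stabilizer (GL (Fin 2) k) (∞ :
      OnePoint k) ⊓ MulAction.stabilizer (GL (Fin 2) k) (((0 : k)) : OnePoint
      k))) hD (cocycleOn_of_le inf_le_left hf)
  set f₁ : GL (Fin 2) k → Matrix (Fin 3) (Fin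
      3) k := fun a => f a - (((Matrix.GeneralLinearGroup.symSq ((a) : GL (Fin 2) k) : GL (Fin 3) k)
      : Matrix (Fin 3) (Fin 3) k) * m₀ * ((Matrix.GeneralLinearGroup.symSq ((a⁻¹) : GL (Fin 2) k) :
      GL (Fin 3) k) : Matrix (Fin 3) (Fin 3) k) - m₀) with hf₁def
  have hf₁ : (∀ a₁ ∈ ((H) : Subgroup (GL (Fin 2) k)), ∀ b₁ ∈ (H), ((f₁) : GL (Fin 2) k → Matrix (Fin
      3) (Fin 3) k) (a₁ * b₁) = ((Matrix.GeneralLinearGroup.symSq ((a₁) : GL (Fin 2) k) : GL (Fin 3)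
      k) : Matrix (Fin 3) (Fin 3) k) * (f₁) b₁ * ((Matrix.GeneralLinearGroup.symSq ((a₁⁻¹) : GL (Fin
      2) k) : GL (Fin 3) k) : Matrix (Fin 3) (Fin 3) k) + (f₁) a₁) := cocycle_sub_coboundary hf m₀
  have hD0 : ∀ d ∈ H, (d : Matrix (Fin 2) (Fin 2) k) 1 0 = 0 → (d : Matrix (Fin 2) (Fin 2)
      k) 0 1 = 0 → f₁ d = 0 := by
    intro d hd h10 h01
    have hdD : d ∈ H ⊓ (MulAction.stabilizer (GL (Fin 2) k) (∞ : OnePoint k) ⊓ MulAction.stabilizer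
        (GL (Fin 2) k) (((0 : k)) : OnePoint k)) := ⟨hd, mem_diag_iff.mpr ⟨h10, h01⟩⟩
    simp only [hf₁def, hm₀ d hdD, sub_self]
  -- Step 2: the Borel cocycle lemma for `φ c = f₁ (1 c; 0 1)`
  set φ : k → Matrix (Fin 3) (Fin 3) k := fun c => f₁ (Matrix.GeneralLinearGroup.upperRightHom
      c) with hφdef
  have hadd : (∀ c₁ ∈ ((F) : Subfield k), ∀ c₂ ∈ (F), ((φ) : k → Matrix (Fin 3) (Fin 3) k) (c₁ + c₂)
      = (φ) c₁ + (!![(1 : k), (c₁), (c₁) ^ 2; 0, 1, 2 * (c₁); 0, 0, 1] : Matrix (Fin 3) (Fin 3) k) *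
      (φ) c₂ * (!![(1 : k), (-c₁), (-c₁) ^ 2; 0, 1, 2 * (-c₁); 0, 0, 1] : Matrix (Fin 3) (Fin 3)
      k)) := by
    intro c hc c' hc'
    simp only [hφdef]
    rw [AddChar.map_add_eq_mul, hf₁ _ (hU c hc) _ (hU c' hc'), symSqMat_upperRightHom,
      symSqMat_upperRightHom_inv, add_comm]
  have hhom : (∀ d₁ ∈ ((F) : Subfield k), d₁ ≠ 0 → ∀ c₁ ∈ (F), ((φ) : k → Matrix (Fin 3) (Fin 3) k)
      (d₁ ^ 2 * c₁) * diagonal ![d₁ ^ 4, d₁ ^ 2, 1] = diagonal ![d₁ ^ 4, d₁ ^ 2, 1] * (φ) c₁) := by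
    intro d hd hd0 c hc
    obtain ⟨h, hh, h10, h01, h00⟩ := hT d hd hd0
    have h11 := (apply_one_one_ne_zero h10).1
    -- `f₁ (h u_c) = S h φ(c) S h⁻¹` and `f₁ (u_{d²c} h) = φ (d² c)`
    have key := hf₁ _ hh _ (hU c hc)
    rw [hD0 h hh h10 h01, add_zero, diag_mul_upperRightHom h10 h01 h00 c,
      hf₁ _ (hU _ (F.mul_mem (F.pow_mem hd 2) hc)) _ hh, hD0 h hh h10 h01, Matrix.mul_zero,
      Matrix.zero_mul, zero_add] at key
    -- `key : φ (d² c) = S h * φ c * S h⁻¹`; multiply by `S h` on the right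
    have key2 : φ (d ^ 2 * c) * ((Matrix.GeneralLinearGroup.symSq ((h) : GL (Fin 2) k) : GL (Fin 3)
        k) : Matrix (Fin 3) (Fin 3) k) = ((Matrix.GeneralLinearGroup.symSq ((h) : GL (Fin 2) k) : GL
        (Fin 3) k) : Matrix (Fin 3) (Fin 3) k) * φ c := by
      simp only [hφdef]
      rw [key, Matrix.mul_assoc, symSqMat_inv_mul, Matrix.mul_one]
    have hSh : ((Matrix.GeneralLinearGroup.symSq ((h) : GL (Fin 2) k) : GL (Fin 3) k) : Matrix (Fin
        3) (Fin 3) k) = (h : Matrix (Fin 2) (Fin 2) k) 1 1 ^ 2 • diagonal ![d ^ 4, d ^ 2, 1] := by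
      rw [symSqMat_of_diag h10 h01, h00]
      ext i j
      fin_cases i <;> fin_cases j <;> simp [Matrix.diagonal] <;> ring
    rw [hSh, Matrix.mul_smul, Matrix.smul_mul] at key2
    exact smul_right_injective _ (pow_ne_zero 2 h11) key2
  obtain ⟨v, -, hv⟩ := borel_cocycle hadd hhom h2 h3 h5 h7
  -- Step 3: `f₁` is the coboundary of `diagonal v` on the Borel part of `H`
  have hBv : ∀ b ∈ H ⊓ MulAction.stabilizer (GL (Fin 2) k) (∞ : OnePoint
      k), f₁ b = ((Matrix.GeneralLinearGroup.symSq ((b) : GL (Fin 2) k) : GL (Fin 3) k) : Matrix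
      (Fin 3) (Fin 3) k) * diagonal v * ((Matrix.GeneralLinearGroup.symSq ((b⁻¹) : GL (Fin 2) k) :
      GL (Fin 3) k) : Matrix (Fin 3) (Fin 3) k) - diagonal v := by
    intro b hbb
    obtain ⟨hb, hbB⟩ := Subgroup.mem_inf.mp hbb
    rw [mem_borel_iff] at hbB
    obtain ⟨c, hc, d, hd, hd10, hd01, rfl⟩ := exists_borel_decomp hU hF hb hbB
    rw [hf₁ _ (hU c hc) _ hd, hD0 d hd hd10 hd01, Matrix.mul_zero, Matrix.zero_mul, zero_add]
    change φ c = _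
    rw [hv c hc, symSqMat_mul, symSqMat_mul_inv_rev, symSqMat_upperRightHom,
      symSqMat_upperRightHom_inv]
    -- `S d` is diagonal and commutes with `diagonal v`
    have hcomm : ((Matrix.GeneralLinearGroup.symSq ((d) : GL (Fin 2) k) : GL (Fin 3) k) : Matrix
        (Fin 3) (Fin 3) k) * diagonal v * ((Matrix.GeneralLinearGroup.symSq ((d⁻¹) : GL (Fin 2) k) :
        GL (Fin 3) k) : Matrix (Fin 3) (Fin 3) k) = diagonal v := by
      have hc' : ((Matrix.GeneralLinearGroup.symSq ((d) : GL (Fin 2) k) : GL (Fin 3) k) : Matrix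
          (Fin 3) (Fin 3) k) * diagonal v = diagonal v * ((Matrix.GeneralLinearGroup.symSq ((d) : GL
          (Fin 2) k) : GL (Fin 3) k) : Matrix (Fin 3) (Fin 3) k) := by
        rw [symSqMat_of_diag hd10 hd01, Matrix.diagonal_mul_diagonal, Matrix.diagonal_mul_diagonal]
        congr 1
        funext i
        exact mul_comm _ _
      rw [hc', Matrix.mul_assoc, symSqMat_mul_inv, Matrix.mul_one]
    rw [show (!![(1 : k), (c), (c) ^ 2; 0, 1, 2 * (c); 0, 0, 1] : Matrix (Fin 3) (Fin 3) k) *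
        ((Matrix.GeneralLinearGroup.symSq ((d) : GL (Fin 2) k) : GL (Fin 3) k) : Matrix (Fin 3) (Fin
        3) k) * diagonal v * (((Matrix.GeneralLinearGroup.symSq ((d⁻¹) : GL (Fin 2) k) : GL (Fin 3)
        k) : Matrix (Fin 3) (Fin 3) k) * (!![(1 : k), (-c), (-c) ^ 2; 0, 1, 2 * (-c); 0, 0, 1] :
        Matrix (Fin 3) (Fin 3) k)) =
        (!![(1 : k), (c), (c) ^ 2; 0, 1, 2 * (c); 0, 0, 1] : Matrix (Fin 3) (Fin 3)
            k) * (((Matrix.GeneralLinearGroup.symSq ((d) : GL (Fin 2) k) : GL (Fin 3) k) : Matrix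
            (Fin 3) (Fin 3) k) * diagonal v * ((Matrix.GeneralLinearGroup.symSq ((d⁻¹) : GL (Fin 2)
            k) : GL (Fin 3) k) : Matrix (Fin 3) (Fin 3) k)) * (!![(1 : k), (-c), (-c) ^ 2; 0, 1, 2 *
            (-c); 0, 0, 1] : Matrix (Fin 3) (Fin 3) k) by noncomm_ring, hcomm]
  -- Step 4: restriction to the Borel part of `H` has invertible index
  obtain ⟨m₁, hm₁⟩ := exists_coboundary_of_relIndex H (H ⊓ MulAction.stabilizer (GL (Fin 2) k) (∞ :
      OnePoint k)) inf_le_left hidx hf₁ hBv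
  refine ⟨m₁ + m₀, fun a ha => ?_⟩
  have : f a = f₁ a + (((Matrix.GeneralLinearGroup.symSq ((a) : GL (Fin 2) k) : GL (Fin 3) k) :
      Matrix (Fin 3) (Fin 3) k) * m₀ * ((Matrix.GeneralLinearGroup.symSq ((a⁻¹) : GL (Fin 2) k) : GL
      (Fin 3) k) : Matrix (Fin 3) (Fin 3) k) - m₀) := by simp only [hf₁def, sub_add_cancel]
  rw [this, hm₁ a ha, Matrix.mul_add, Matrix.add_mul]
  abel


/-- **No `l`-group quotients for a subgroup in normal form.**  With `H`, `F` as in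
`exists_coboundary_of_normalForm` (`char k = l ∉ {2, 3}`, diagonal part of order prime to `l`,
upper triangular part of index prime to `l`), every surjection from `H` onto a finite `l`-group is
trivial: an `l`-group image kills the diagonal part (order prime to `l`), hence the translations
(`t u t⁻¹ = u⁴` for `t = diag(4e, e)` forces `ψ(u)³ = 1 = ψ(u)ˡ`), hence the Borel part, whose
index is prime to `l`. [folklore] -/
theorem card_eq_one_of_normalForm (l : ℕ) [Fact l.Prime] [CharP k l] (hl3 : l ≠ 3)
    (h2 : (2 : k) ≠ 0) (H : Subgroup (GL (Fin 2) k)) [Finite H] (F : Subfield k)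
    (hU : (∀ c₁ ∈ ((F) : Subfield k), Matrix.GeneralLinearGroup.upperRightHom c₁ ∈ ((H) : Subgroup
        (GL (Fin 2) k)))) (hT : (∀ d₁ ∈ ((F) : Subfield k), d₁ ≠ 0 → ∃ h₁ ∈ ((H) : Subgroup (GL (Fin
        2) k)), (h₁ : Matrix (Fin 2) (Fin 2) k) 1 0 = 0 ∧ (h₁ : Matrix (Fin 2) (Fin 2) k) 0 1 = 0 ∧
        (h₁ : Matrix (Fin 2) (Fin 2) k) 0 0 = d₁ ^ 2 * (h₁ : Matrix (Fin 2) (Fin 2) k) 1 1)) (hF :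
        (∀ h₁ ∈ ((H) : Subgroup (GL (Fin 2) k)), ∃ s₁ : k, s₁ ≠ 0 ∧ ∀ i j, s₁ * (h₁ : Matrix (Fin 2)
        (Fin 2) k) i j ∈ ((F) : Subfield k)))
    (hD : ¬ l ∣ Nat.card (H ⊓ (MulAction.stabilizer (GL (Fin 2) k) (∞ : OnePoint k) ⊓
        MulAction.stabilizer (GL (Fin 2) k) (((0 : k)) : OnePoint k)) : Subgroup (GL (Fin 2) k)))
    (hidx : ¬ l ∣ (H ⊓ MulAction.stabilizer (GL (Fin 2) k) (∞ : OnePoint k)).relIndex H)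
    {Q : Type*} [Group Q] [Finite Q] (hQ : IsPGroup l Q) (ψ : H →* Q)
    (hψ : Function.Surjective ψ) : Nat.card Q = 1 := by
  haveI : Finite (H ⊓ (MulAction.stabilizer (GL (Fin 2) k) (∞ : OnePoint k) ⊓ MulAction.stabilizer
      (GL (Fin 2) k) (((0 : k)) : OnePoint k)) : Subgroup (GL (Fin 2) k)) :=
    Finite.of_injective _ (Subgroup.inclusion_injective (inf_le_left : H ⊓ (MulAction.stabilizer (GL
        (Fin 2) k) (∞ : OnePoint k) ⊓ MulAction.stabilizer (GL (Fin 2) k) (((0 : k)) : OnePoint k))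
        ≤ H))
  -- (i) `ψ` kills the diagonal part of `H`
  have hψD : ∀ x : H, ((x : GL (Fin 2) k) : Matrix (Fin 2) (Fin 2) k) 1 0 = 0 → ((x : GL (Fin 2) k)
      : Matrix (Fin 2) (Fin 2) k) 0 1 = 0 →
      ψ x = 1 := by
    intro x h10 h01
    obtain ⟨j, hj⟩ := IsPGroup.iff_orderOf.mp hQ (ψ x)
    have hdvd : orderOf (ψ x) ∣ Nat.card (H ⊓ (MulAction.stabilizer (GL (Fin 2) k) (∞ : OnePoint k)
        ⊓ MulAction.stabilizer (GL (Fin 2) k) (((0 : k)) : OnePoint k)) : Subgroup (GL (Fin 2)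
        k)) := by
      have h1 : orderOf (ψ x) ∣ orderOf x := orderOf_map_dvd ψ x
      let y : (H ⊓ (MulAction.stabilizer (GL (Fin 2) k) (∞ : OnePoint k) ⊓ MulAction.stabilizer (GL
          (Fin 2) k) (((0 : k)) : OnePoint k)) : Subgroup (GL (Fin 2) k)) :=
        ⟨x, Subgroup.mem_inf.mpr ⟨x.2, mem_diag_iff.mpr ⟨h10, h01⟩⟩⟩
      have h2' : orderOf x = orderOf y := by
        rw [← Subgroup.orderOf_coe x, ← Subgroup.orderOf_coe y]
      rw [h2'] at h1
      exact h1.trans (orderOf_dvd_natCard y)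
    rw [hj] at hdvd
    cases j with
    | zero => exact orderOf_eq_one_iff.mp (by rw [hj, pow_zero])
    | succ j => exact absurd ((dvd_pow_self l (Nat.succ_ne_zero j)).trans hdvd) hD
  -- (ii) `ψ` kills the translations
  have h2F : (2 : k) ∈ F := by simp
  obtain ⟨t, ht, ht10, ht01, ht00⟩ := hT 2 h2F h2
  have hψU : ∀ c (hc : c ∈ F), ψ ⟨Matrix.GeneralLinearGroup.upperRightHom c, hU c hc⟩ = 1 := by
    intro c hc
    set u : H := ⟨Matrix.GeneralLinearGroup.upperRightHom c, hU c hc⟩ with hu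
    have hconj : (⟨t, ht⟩ : H) * u = u ^ 4 * ⟨t, ht⟩ := by
      apply Subtype.ext
      change t * Matrix.GeneralLinearGroup.upperRightHom c =
        Matrix.GeneralLinearGroup.upperRightHom c ^ 4 * t
      rw [diag_mul_upperRightHom ht10 ht01 ht00 c, ← AddChar.map_nsmul_eq_pow, nsmul_eq_mul]
      norm_num
    have h4 : ψ u ^ 4 = ψ u := by
      have := congrArg ψ hconj
      rw [map_mul, map_mul, map_pow, hψD ⟨t, ht⟩ ht10 ht01, one_mul, mul_one] at this
      exact this.symm
    have hul : u ^ l = 1 := by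
      apply Subtype.ext
      change Matrix.GeneralLinearGroup.upperRightHom c ^ l = 1
      rw [← AddChar.map_nsmul_eq_pow, nsmul_eq_mul, CharP.cast_eq_zero, zero_mul,
        AddChar.map_zero_eq_one]
    have hl : ψ u ^ l = 1 := by rw [← map_pow, hul, map_one]
    have h3 : ψ u ^ 3 = 1 := by
      have : ψ u ^ 3 * ψ u = 1 * ψ u := by rw [← pow_succ, h4, one_mul]
      exact mul_right_cancel this
    have hd3 : orderOf (ψ u) ∣ 3 := orderOf_dvd_of_pow_eq_one h3
    have hdl : orderOf (ψ u) ∣ l := orderOf_dvd_of_pow_eq_one hl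
    have hcop : Nat.Coprime 3 l :=
      (Nat.coprime_primes Nat.prime_three Fact.out).mpr (Ne.symm hl3)
    have h1 : orderOf (ψ u) ∣ 1 := by
      have := Nat.dvd_gcd hd3 hdl
      rwa [Nat.coprime_iff_gcd_eq_one.mp hcop] at this
    exact orderOf_eq_one_iff.mp (Nat.dvd_one.mp h1)
  -- (iii) `ψ` kills the Borel part of `H`
  have hψB : ∀ x : H, ((x : GL (Fin 2) k) : Matrix (Fin 2) (Fin 2) k) 1 0 = 0 → ψ x = 1 := by
    intro x h10
    obtain ⟨c, hc, d, hd, hd10, hd01, hx⟩ := exists_borel_decomp hU hF x.2 h10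
    have : x = ⟨_, hU c hc⟩ * ⟨d, hd⟩ := Subtype.ext hx
    rw [this, map_mul, hψU c hc, hψD ⟨d, hd⟩ hd10 hd01, one_mul]
  -- (iv) the index of the Borel part is prime to `l`
  have hker : (H ⊓ MulAction.stabilizer (GL (Fin 2) k) (∞ : OnePoint k)).subgroupOf H ≤ ψ.ker := by
    intro x hx
    rw [Subgroup.mem_subgroupOf, Subgroup.mem_inf, mem_borel_iff] at hx
    exact hψB x hx.2
  have h1 : ψ.ker.index = Nat.card Q := by
    rw [Subgroup.index_ker, MonoidHom.range_eq_top.mpr hψ, Subgroup.card_top]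
  have h2' : ψ.ker.index ∣ (H ⊓ MulAction.stabilizer (GL (Fin 2) k) (∞ : OnePoint
      k)).relIndex H := Subgroup.index_dvd_of_le hker
  obtain ⟨n, hn⟩ := hQ.exists_card_eq
  rw [h1, hn] at h2'
  cases n with
  | zero => rw [hn, pow_zero]
  | succ n => exact absurd ((dvd_pow_self l (Nat.succ_ne_zero n)).trans h2') hidx



/-! ### From the projective image to the normal form

If the image `H̄` of a finite `H ≤ GL₂(k)` in `PGL₂(k)` satisfies `PSL₂(F) ≤ H̄ ≤ PGL₂(F)`
for a finite subfield `F`, then `H` is in normal form: it contains the translations by `F`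
(a scalar multiple `s·(1 c; 0 1)` lies in `H`; raising to the prime-to-`l` part `m` of its
order kills the scalar, and `m` is invertible modulo `l`), a scalar multiple of
`diag(d², 1)` for `d ∈ Fˣ`, and only scalar multiples of `F`-rational matrices.  The order of
the scalar part of `H` is prime to `l`, and `[H : H ∩ B]` is prime to `l` as soon as
`l·|F| ∤ |H̄|` (which holds for `H̄ = PSL₂(F)` and `H̄ = PGL₂(F)`). -/

section FromProjective

open Literature.GroupTheory.SpecificGroups

omit [DecidableEq k] in
/-- Powers of a scalar multiple of a translation. [folklore] -/
theorem coe_pow_of_eq_smul_transl {h : GL (Fin 2) k} {s c : k} (hh : (h : Matrix (Fin 2) (Fin 2) k)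
    = s • !![1, c; 0, 1])
    (j : ℕ) : ((h ^ j : GL (Fin 2) k) : Matrix (Fin 2) (Fin 2) k) = s ^ j • !![1, (j : k) * c; 0,
        1] := by
  rw [Units.val_pow_eq_pow_val, hh, smul_pow]
  congr 1
  rw [← coe_upperRightHom, ← Units.val_pow_eq_pow_val, ← AddChar.map_nsmul_eq_pow, nsmul_eq_mul,
    coe_upperRightHom]

omit [DecidableEq k] in
/-- **Translations.**  If `PSL₂(F) ≤ H̄` then `H` contains the translations `(1 c; 0 1)`,
`c ∈ F`. [folklore] -/
theorem hasTransl_of_pslTwo_le (l : ℕ) [Fact l.Prime] [CharP k l] (H : Subgroup (GL (Fin 2) k))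
    [Finite H] (F : Subfield k)
    (hle : PGL2.pslTwo F ≤ H.map (Matrix.ProjGenLinGroup.mk : GL (Fin 2) k →* PGL(Fin 2, k))) :
    (∀ c₁ ∈ ((F) : Subfield k), Matrix.GeneralLinearGroup.upperRightHom c₁ ∈ ((H) : Subgroup (GL
        (Fin 2) k))) := by
  intro c hc
  have hl : l.Prime := Fact.out
  -- a scalar multiple of the translation lies in `H`
  obtain ⟨h, hh, hmk⟩ := Subgroup.mem_map.mp (hle (PGL2.transl_mem_pslTwo F hc))
  rw [PGL2.transl_apply, GL2.mk_eq_mk_iff_smul] at hmk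
  obtain ⟨u, hu⟩ := hmk
  have hh' : (h : Matrix (Fin 2) (Fin 2) k) = ((u⁻¹ : kˣ) : k) • !![1, c; 0, 1] := by
    rw [← coe_upperRightHom, ← hu, smul_smul, Units.inv_mul, one_smul]
  -- the order of `h` and its prime-to-`l` part
  set n := orderOf (⟨h, hh⟩ : H) with hn
  have hn0 : n ≠ 0 := (orderOf_pos _).ne'
  obtain ⟨e, m, hm, hnm⟩ := Nat.exists_eq_pow_mul_and_not_dvd hn0 l hl.one_lt.ne'
  have hpow : ∀ j : ℕ, ((h ^ j : GL (Fin 2) k) : Matrix (Fin 2) (Fin 2) k) =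
      ((u⁻¹ : kˣ) : k) ^ j • !![1, (j : k) * c; 0, 1] := coe_pow_of_eq_smul_transl hh'
  have hn1 : h ^ n = 1 := by
    have h1 := pow_orderOf_eq_one (⟨h, hh⟩ : H)
    rw [← hn] at h1
    exact congrArg Subtype.val h1
  have hs : ((u⁻¹ : kˣ) : k) ^ m = 1 := by
    have h00 := congrFun (congrFun (congrArg (fun g : GL (Fin 2) k => (g : Matrix (Fin 2) (Fin 2)
        k)) hn1) 0) 0
    simp only [hpow n, Matrix.GeneralLinearGroup.coe_one, Matrix.smul_apply, Matrix.one_apply_eq]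
      at h00
    simp only [Matrix.of_apply, Matrix.cons_val', Matrix.cons_val_zero, smul_eq_mul, mul_one] at h00
    rw [hnm] at h00
    exact (ExpChar.pow_prime_pow_mul_eq_one_iff l e m _).mp h00
  have hmem : Matrix.GeneralLinearGroup.upperRightHom ((m : k) * c) ∈ H := by
    have heq : h ^ m = Matrix.GeneralLinearGroup.upperRightHom ((m : k) * c) := by
      apply Units.ext
      rw [hpow m, hs, one_smul, coe_upperRightHom]
    rw [← heq]
    exact H.pow_mem hh m
  -- invert `m` modulo `l`
  have hcop : Nat.Coprime m l := ((Nat.Prime.coprime_iff_not_dvd hl).mpr hm).symm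
  obtain ⟨j, -, hj⟩ := Nat.exists_mul_mod_eq_one_of_coprime hcop hl.one_lt
  have hmj : ((m * j : ℕ) : k) = 1 := by
    have hdm := Nat.div_add_mod (m * j) l
    rw [hj] at hdm
    rw [← hdm, Nat.cast_add, Nat.cast_mul, CharP.cast_eq_zero k l, zero_mul, zero_add,
      Nat.cast_one]
  have heq : Matrix.GeneralLinearGroup.upperRightHom c =
      Matrix.GeneralLinearGroup.upperRightHom ((m : k) * c) ^ j := by
    rw [← AddChar.map_nsmul_eq_pow, nsmul_eq_mul, ← mul_assoc, ← Nat.cast_mul, mul_comm j m, hmj,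
      one_mul]
  rw [heq]
  exact H.pow_mem hmem j

omit [DecidableEq k] in
/-- **Torus.**  If `PSL₂(F) ≤ H̄` then `H` contains a scalar multiple of
`diag(d², 1) ~ diag(d, d⁻¹)` for every `d ∈ Fˣ`. [folklore] -/
theorem hasTorus_of_pslTwo_le (H : Subgroup (GL (Fin 2) k)) (F : Subfield k)
    (hle : PGL2.pslTwo F ≤ H.map (Matrix.ProjGenLinGroup.mk : GL (Fin 2) k →* PGL(Fin 2, k))) :
    (∀ d₁ ∈ ((F) : Subfield k), d₁ ≠ 0 → ∃ h₁ ∈ ((H) : Subgroup (GL (Fin 2) k)), (h₁ : Matrix (Fin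
        2) (Fin 2) k) 1 0 = 0 ∧ (h₁ : Matrix (Fin 2) (Fin 2) k) 0 1 = 0 ∧ (h₁ : Matrix (Fin 2) (Fin
        2) k) 0 0 = d₁ ^ 2 * (h₁ : Matrix (Fin 2) (Fin 2) k) 1 1) := by
  intro d hd hd0
  obtain ⟨h, hh, hmk⟩ := Subgroup.mem_map.mp (hle (PGL2.homoth_mul_self_mem_pslTwo F hd hd0))
  rw [PGL2.homoth_apply, GL2.mk_eq_mk_iff_smul] at hmk
  obtain ⟨u, hu⟩ := hmk
  rw [PGL2.diagGL_val] at hu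
  have e10 := congrFun (congrFun hu 1) 0
  have e01 := congrFun (congrFun hu 0) 1
  have e00 := congrFun (congrFun hu 0) 0
  have e11 := congrFun (congrFun hu 1) 1
  simp only [Matrix.smul_apply, smul_eq_mul, Matrix.of_apply, Matrix.cons_val',
      Matrix.cons_val_zero,
    Matrix.cons_val_one, Units.val_mul, Units.val_mk0] at e10 e01 e00 e11
  refine ⟨h, hh, (mul_eq_zero.mp e10).resolve_left u.ne_zero,
    (mul_eq_zero.mp e01).resolve_left u.ne_zero, ?_⟩
  apply mul_left_cancel₀ u.ne_zero
  linear_combination e00 - d ^ 2 * e11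

omit [DecidableEq k] in
/-- **Rationality.**  If `H̄ ≤ PGL₂(F)` then every element of `H` is a scalar multiple of an
`F`-rational matrix. [folklore] -/
theorem isRational_of_le_pglTwo (H : Subgroup (GL (Fin 2) k)) (F : Subfield k)
    (hle : H.map (Matrix.ProjGenLinGroup.mk : GL (Fin 2) k →* PGL(Fin 2, k)) ≤ PGL2.pglTwo F) :
    (∀ h₁ ∈ ((H) : Subgroup (GL (Fin 2) k)), ∃ s₁ : k, s₁ ≠ 0 ∧ ∀ i j, s₁ * (h₁ : Matrix (Fin 2)
        (Fin 2) k) i j ∈ ((F) : Subfield k)) := by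
  intro h hh
  obtain ⟨x, hx⟩ := hle (Subgroup.mem_map_of_mem _ hh)
  induction x using Matrix.ProjGenLinGroup.induction_on with
  | mk g =>
    rw [Matrix.ProjGenLinGroup.map_mk, GL2.mk_eq_mk_iff_smul] at hx
    obtain ⟨u, hu⟩ := hx
    refine ⟨((u⁻¹ : kˣ) : k), (u⁻¹).ne_zero, fun i j => ?_⟩
    have hij := congrFun (congrFun hu i) j
    rw [Matrix.smul_apply, smul_eq_mul] at hij
    rw [← hij, ← mul_assoc, Units.inv_mul, one_mul]
    change F.subtype (g i j) ∈ F
    exact (g i j).2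

/-- The translations by `F` inject `F` into the Borel part of `H`, so `|F| ∣ |H ∩ B|`.
[folklore] -/
theorem card_dvd_card_inf_borel (H : Subgroup (GL (Fin 2) k)) (F : Subfield k)
    (hU : (∀ c₁ ∈ ((F) : Subfield k), Matrix.GeneralLinearGroup.upperRightHom c₁ ∈ ((H) : Subgroup
        (GL (Fin 2) k)))) : Nat.card F ∣ Nat.card (H ⊓ MulAction.stabilizer (GL (Fin 2) k) (∞ :
        OnePoint k) : Subgroup (GL (Fin 2) k)) := by
  let τ₀ : Multiplicative F →* GL (Fin 2) k :=
    ((Matrix.GeneralLinearGroup.upperRightHom (R := k)).compAddMonoidHom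
      F.subtype.toAddMonoidHom).toMonoidHom
  have hτ₀ : ∀ x, τ₀ x = Matrix.GeneralLinearGroup.upperRightHom ((x.toAdd : F) : k) := fun x => rfl
  have hmem : ∀ x, τ₀ x ∈ (H ⊓ MulAction.stabilizer (GL (Fin 2) k) (∞ : OnePoint k) : Subgroup (GL
      (Fin 2) k)) := by
    intro x
    rw [hτ₀]
    refine Subgroup.mem_inf.mpr ⟨hU _ (x.toAdd).2, mem_borel_iff.mpr ?_⟩
    rw [coe_upperRightHom]
    simp
  have hinj : Function.Injective (τ₀.codRestrict _ hmem) := by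
    rw [MonoidHom.injective_codRestrict]
    intro x y hxy
    rw [hτ₀, hτ₀] at hxy
    have h1 := Matrix.GeneralLinearGroup.injective_upperRightHom hxy
    exact Multiplicative.toAdd.injective (Subtype.ext h1)
  have h := Subgroup.card_dvd_of_injective _ hinj
  rwa [Nat.card_congr (Multiplicative.toAdd : Multiplicative F ≃ F)] at h

omit [DecidableEq k] in
/-- The scalar part `H ∩ Z(GL₂)` of a finite `H` has order prime to `l = char k`. [folklore] -/
theorem not_dvd_card_inf_center (l : ℕ) [Fact l.Prime] [CharP k l] (H : Subgroup (GL (Fin 2) k))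
    [Finite H] :
    ¬ l ∣ Nat.card (H ⊓ Subgroup.center (GL (Fin 2) k) : Subgroup (GL (Fin 2) k)) := by
  haveI : Finite (H ⊓ Subgroup.center (GL (Fin 2) k) : Subgroup (GL (Fin 2) k)) :=
    Finite.of_injective _ (Subgroup.inclusion_injective
      (inf_le_left : H ⊓ Subgroup.center (GL (Fin 2) k) ≤ H))
  refine not_dvd_card_of_diag l _ (fun g hg => ?_)
  have hc := GL2.mem_center_iff.mp (Subgroup.mem_inf.mp hg).2
  exact ⟨hc.2.1, hc.1⟩

omit [DecidableEq k] in
/-- `|H| = |H ∩ Z| · |H̄|` for the image `H̄` of `H` in `PGL₂(k)`. [folklore] -/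
theorem card_eq_card_inf_center_mul (H : Subgroup (GL (Fin 2) k)) :
    Nat.card H = Nat.card (H ⊓ Subgroup.center (GL (Fin 2) k) : Subgroup (GL (Fin 2) k)) *
      Nat.card (H.map (Matrix.ProjGenLinGroup.mk : GL (Fin 2) k →* PGL(Fin 2, k))) := by
  set ψ : H →* PGL(Fin 2, k) := Matrix.ProjGenLinGroup.mk.comp H.subtype with hψ
  have hker : ψ.ker = (Subgroup.center (GL (Fin 2) k)).subgroupOf H := by
    rw [hψ, ← MonoidHom.comap_ker, Matrix.ProjGenLinGroup.ker_mk]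
    rfl
  have hcardker : Nat.card ψ.ker =
      Nat.card (H ⊓ Subgroup.center (GL (Fin 2) k) : Subgroup (GL (Fin 2) k)) := by
    rw [hker, ← Subgroup.card_map_of_injective H.subtype_injective,
      Subgroup.subgroupOf_map_subtype, inf_comm]
  have hrange : ψ.range = H.map Matrix.ProjGenLinGroup.mk := by
    rw [hψ, MonoidHom.range_comp, Subgroup.range_subtype]
  rw [← hrange, ← Subgroup.index_ker, ← hcardker, Subgroup.card_mul_index]

/-- **The index of the Borel part is prime to `l`** when `l·|F| ∤ |H̄|`. [folklore] -/
theorem not_dvd_relIndex_borel (l : ℕ) [Fact l.Prime] [CharP k l] (H : Subgroup (GL (Fin 2) k))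
    [Finite H] (F : Subfield k) [Finite F] (hU : (∀ c₁ ∈ ((F) : Subfield k),
        Matrix.GeneralLinearGroup.upperRightHom c₁ ∈ ((H) : Subgroup (GL (Fin 2) k))))
    (hbar : ¬ l * Nat.card F ∣
      Nat.card (H.map (Matrix.ProjGenLinGroup.mk : GL (Fin 2) k →* PGL(Fin 2, k)))) :
    ¬ l ∣ (H ⊓ MulAction.stabilizer (GL (Fin 2) k) (∞ : OnePoint k)).relIndex H := by
  intro hdvd
  have hl : l.Prime := Fact.out
  haveI : Fintype F := Fintype.ofFinite F
  obtain ⟨n, -, hn⟩ := FiniteField.card F l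
  have hq : Nat.card F = l ^ (n : ℕ) := by rw [Nat.card_eq_fintype_card, hn]
  have hmul : Nat.card (H ⊓ MulAction.stabilizer (GL (Fin 2) k) (∞ : OnePoint k) : Subgroup (GL (Fin
      2) k)) * (H ⊓ MulAction.stabilizer (GL (Fin 2) k) (∞ : OnePoint
      k)).relIndex H = Nat.card H := by
    have h := Subgroup.relIndex_mul_relIndex (⊥ : Subgroup (GL (Fin 2) k)) (H ⊓ MulAction.stabilizer
        (GL (Fin 2) k) (∞ : OnePoint k)) H bot_le
      inf_le_left
    rwa [Subgroup.relIndex_bot_left, Subgroup.relIndex_bot_left] at h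
  have h1 : l * Nat.card F ∣ Nat.card H := by
    rw [← hmul, mul_comm l]
    exact Nat.mul_dvd_mul (card_dvd_card_inf_borel H F hU) hdvd
  rw [card_eq_card_inf_center_mul, mul_comm (Nat.card (H ⊓ Subgroup.center (GL (Fin 2) k) :
    Subgroup (GL (Fin 2) k)))] at h1
  have hcop : Nat.Coprime (l * Nat.card F)
      (Nat.card (H ⊓ Subgroup.center (GL (Fin 2) k) : Subgroup (GL (Fin 2) k))) := by
    rw [hq, ← pow_succ']
    exact ((Nat.Prime.coprime_iff_not_dvd hl).mpr (not_dvd_card_inf_center l H)).pow_left _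
  exact hbar (hcop.dvd_of_dvd_mul_right h1)

omit [DecidableEq k] in
/-- `l·|F| ∤ |PSL₂(F)|` and `l·|F| ∤ |PGL₂(F)|` (`l = char k` odd): the orders are
`|F|(|F|² - 1)/2` and `|F|(|F|² - 1)`. [folklore] -/
theorem not_dvd_card_of_eq_pslTwo_or (l : ℕ) [Fact l.Prime] [CharP k l] (hl2 : l ≠ 2)
    (F : Subfield k) [Finite F]
    {G : Subgroup PGL(Fin 2, k)} (hG : G = PGL2.pslTwo F ∨ G = PGL2.pglTwo F) :
    ¬ l * Nat.card F ∣ Nat.card G := by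
  have hl : l.Prime := Fact.out
  haveI : Fintype F := Fintype.ofFinite F
  obtain ⟨n, -, hn⟩ := FiniteField.card F l
  have hq : Nat.card F = l ^ (n : ℕ) := by rw [Nat.card_eq_fintype_card, hn]
  have key : ∃ e, e * Nat.card G = Nat.card F * (Nat.card F ^ 2 - 1) := by
    rcases hG with rfl | rfl
    · exact ⟨2, PGL2.two_mul_card_pslTwo F l hl2⟩
    · exact ⟨1, by rw [one_mul, PGL2.card_pglTwo]⟩
  obtain ⟨e, hcard⟩ := key
  intro hdvd
  have h1 : Nat.card F * l ∣ Nat.card F * (Nat.card F ^ 2 - 1) := by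
    rw [← hcard, mul_comm (Nat.card F)]
    exact hdvd.mul_left e
  have hqpos : 0 < Nat.card F := Nat.card_pos
  have h2 : l ∣ Nat.card F ^ 2 - 1 := Nat.dvd_of_mul_dvd_mul_left hqpos h1
  have h3 : l ∣ Nat.card F ^ 2 := by
    rw [hq, ← pow_mul]
    exact dvd_pow_self l (by positivity)
  have h4 : l ∣ Nat.card F ^ 2 - (Nat.card F ^ 2 - 1) := Nat.dvd_sub h3 h2
  rw [Nat.sub_sub_self (Nat.one_le_pow _ _ hqpos)] at h4
  exact hl.one_lt.ne' (Nat.dvd_one.mp h4)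

end FromProjective

end NormalForm



/-! ### Conjugation invariance -/

section Conjugation

open scoped Pointwise

/-- Membership in a conjugate subgroup: `a ∈ xHx⁻¹ ↔ x⁻¹ax ∈ H`. [folklore] -/
theorem mem_conj_smul_iff {G : Type*} [Group G] {H : Subgroup G} {x a : G} :
    a ∈ MulAut.conj x • H ↔ x⁻¹ * a * x ∈ H := by
  rw [Subgroup.mem_pointwise_smul_iff_inv_smul_mem, ← map_inv, MulAut.smul_def, MulAut.conj_apply,
    inv_inv]

/-- The image in `PGL₂` of a conjugate is the conjugate of the image. [folklore] -/
theorem map_mk_conj_smul (H : Subgroup (GL (Fin 2) k)) (x : GL (Fin 2) k) :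
    (MulAut.conj x • H).map (Matrix.ProjGenLinGroup.mk : GL (Fin 2) k →* PGL(Fin 2, k)) =
      MulAut.conj (Matrix.ProjGenLinGroup.mk x) • H.map Matrix.ProjGenLinGroup.mk := by
  ext y
  constructor
  · intro hy'
    obtain ⟨a, ha, rfl⟩ := Subgroup.mem_map.mp hy'
    rw [mem_conj_smul_iff] at ha
    rw [mem_conj_smul_iff, ← map_inv, ← map_mul, ← map_mul]
    exact Subgroup.mem_map_of_mem _ ha
  · intro hy
    rw [mem_conj_smul_iff] at hy
    obtain ⟨b, hb, hb'⟩ := Subgroup.mem_map.mp hy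
    refine ⟨x * b * x⁻¹, mem_conj_smul_iff.mpr ?_, ?_⟩
    · rwa [show x⁻¹ * (x * b * x⁻¹) * x = b by group]
    · rw [map_mul, map_mul, map_inv, hb']
      group

/-- `Ad ∘ Sym²` is multiplicative: conjugating by `Sym²(ab)` is conjugating by `Sym² b` then by
`Sym² a`. [folklore] -/
theorem conjS_mul (a b : GL (Fin 2) k) (M : Matrix (Fin 3) (Fin 3) k) :
    ((Matrix.GeneralLinearGroup.symSq ((a * b) : GL (Fin 2) k) : GL (Fin 3) k) : Matrix (Fin 3) (Fin
        3) k) * M * ((Matrix.GeneralLinearGroup.symSq (((a * b)⁻¹) : GL (Fin 2) k) : GL (Fin 3) k) :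
        Matrix (Fin 3) (Fin 3) k) = ((Matrix.GeneralLinearGroup.symSq ((a) : GL (Fin 2) k) : GL (Fin
        3) k) : Matrix (Fin 3) (Fin 3) k) * (((Matrix.GeneralLinearGroup.symSq ((b) : GL (Fin 2) k)
        : GL (Fin 3) k) : Matrix (Fin 3) (Fin 3) k) * M * ((Matrix.GeneralLinearGroup.symSq ((b⁻¹) :
        GL (Fin 2) k) : GL (Fin 3) k) : Matrix (Fin 3) (Fin 3)
        k)) * ((Matrix.GeneralLinearGroup.symSq ((a⁻¹) : GL (Fin 2) k) : GL (Fin 3) k) : Matrix (Fin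
        3) (Fin 3) k) := by
  rw [symSqMat_mul_inv_rev, symSqMat_mul]
  simp only [Matrix.mul_assoc]

/-- Conjugation by `Sym²(1)` is the identity. [folklore] -/
theorem conjS_one (M : Matrix (Fin 3) (Fin 3) k) : ((Matrix.GeneralLinearGroup.symSq (((1 : GL (Fin
    2) k)) : GL (Fin 2) k) : GL (Fin 3) k) : Matrix (Fin 3) (Fin 3)
    k) * M * ((Matrix.GeneralLinearGroup.symSq (((1 : GL (Fin 2) k)⁻¹) : GL (Fin 2) k) : GL (Fin 3)
    k) : Matrix (Fin 3) (Fin 3) k) = M := by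
  rw [inv_one, symSqMat_one, Matrix.one_mul, Matrix.mul_one]

/-- **Conjugation invariance of `H¹ = 0`**: if every `1`-cocycle of `xHx⁻¹` is a coboundary,
so is every `1`-cocycle of `H` (transport `f ↦ (a ↦ Sym²x · f(x⁻¹ax) · Sym²x⁻¹)`). [folklore] -/
theorem exists_coboundary_of_conj {H : Subgroup (GL (Fin 2) k)} (x : GL (Fin 2) k)
    (hH' : ∀ f' : GL (Fin 2) k → Matrix (Fin 3) (Fin 3) k, (∀ a₁ ∈ ((MulAut.conj x • H) : Subgroup
        (GL (Fin 2) k)), ∀ b₁ ∈ (MulAut.conj x • H), ((f') : GL (Fin 2) k → Matrix (Fin 3) (Fin 3)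
        k) (a₁ * b₁) = ((Matrix.GeneralLinearGroup.symSq ((a₁) : GL (Fin 2) k) : GL (Fin 3) k) :
        Matrix (Fin 3) (Fin 3) k) * (f') b₁ * ((Matrix.GeneralLinearGroup.symSq ((a₁⁻¹) : GL (Fin 2)
        k) : GL (Fin 3) k) : Matrix (Fin 3) (Fin 3) k) + (f') a₁) →
      ∃ m' : Matrix (Fin 3) (Fin
          3) k, ∀ a ∈ MulAut.conj x • H, f' a = ((Matrix.GeneralLinearGroup.symSq ((a) : GL (Fin 2)
          k) : GL (Fin 3) k) : Matrix (Fin 3) (Fin 3) k) * m' * ((Matrix.GeneralLinearGroup.symSq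
          ((a⁻¹) : GL (Fin 2) k) : GL (Fin 3) k) : Matrix (Fin 3) (Fin 3) k) - m')
    {f : GL (Fin 2) k → Matrix (Fin 3) (Fin 3) k} (hf : (∀ a₁ ∈ ((H) : Subgroup (GL (Fin 2) k)), ∀
        b₁ ∈ (H), ((f) : GL (Fin 2) k → Matrix (Fin 3) (Fin 3) k) (a₁ * b₁) =
        ((Matrix.GeneralLinearGroup.symSq ((a₁) : GL (Fin 2) k) : GL (Fin 3) k) : Matrix (Fin 3)
        (Fin 3) k) * (f) b₁ * ((Matrix.GeneralLinearGroup.symSq ((a₁⁻¹) : GL (Fin 2) k) : GL (Fin 3)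
        k) : Matrix (Fin 3) (Fin 3) k) + (f) a₁)) :
    ∃ m : Matrix (Fin 3) (Fin 3) k, ∀ a ∈ H, f a = ((Matrix.GeneralLinearGroup.symSq ((a) : GL (Fin
        2) k) : GL (Fin 3) k) : Matrix (Fin 3) (Fin 3) k) * m * ((Matrix.GeneralLinearGroup.symSq
        ((a⁻¹) : GL (Fin 2) k) : GL (Fin 3) k) : Matrix (Fin 3) (Fin 3) k) - m := by
  set f' : GL (Fin 2) k → Matrix (Fin 3) (Fin 3) k := fun a => ((Matrix.GeneralLinearGroup.symSq
      ((x) : GL (Fin 2) k) : GL (Fin 3) k) : Matrix (Fin 3) (Fin 3) k) * f (x⁻¹ * a *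
      x) * ((Matrix.GeneralLinearGroup.symSq ((x⁻¹) : GL (Fin 2) k) : GL (Fin 3) k) : Matrix (Fin 3)
      (Fin 3) k) with hf'def
  have hf' : (∀ a₁ ∈ ((MulAut.conj x • H) : Subgroup (GL (Fin 2) k)), ∀ b₁ ∈ (MulAut.conj x • H),
      ((f') : GL (Fin 2) k → Matrix (Fin 3) (Fin 3) k) (a₁ * b₁) = ((Matrix.GeneralLinearGroup.symSq
      ((a₁) : GL (Fin 2) k) : GL (Fin 3) k) : Matrix (Fin 3) (Fin 3) k) * (f') b₁ *
      ((Matrix.GeneralLinearGroup.symSq ((a₁⁻¹) : GL (Fin 2) k) : GL (Fin 3) k) : Matrix (Fin 3)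
      (Fin 3) k) + (f') a₁) := by
    intro a ha b hb
    rw [mem_conj_smul_iff] at ha hb
    simp only [hf'def]
    rw [show x⁻¹ * (a * b) * x = (x⁻¹ * a * x) * (x⁻¹ * b * x) by group, hf _ ha _ hb,
      Matrix.mul_add, Matrix.add_mul, ← conjS_mul, show x * (x⁻¹ * a * x) = a * x by group,
      conjS_mul]
  obtain ⟨m', hm'⟩ := hH' f' hf'
  refine ⟨((Matrix.GeneralLinearGroup.symSq ((x⁻¹) : GL (Fin 2) k) : GL (Fin 3) k) : Matrix (Fin 3)
      (Fin 3) k) * m' * ((Matrix.GeneralLinearGroup.symSq ((x⁻¹⁻¹) : GL (Fin 2) k) : GL (Fin 3) k) :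
      Matrix (Fin 3) (Fin 3) k), fun a ha => ?_⟩
  have hax : x * a * x⁻¹ ∈ MulAut.conj x • H :=
    mem_conj_smul_iff.mpr (by rwa [show x⁻¹ * (x * a * x⁻¹) * x = a by group])
  have key := hm' _ hax
  simp only [hf'def, show x⁻¹ * (x * a * x⁻¹) * x = a by group] at key
  -- apply `Ad (Sym² x⁻¹)` to `key`
  calc f a = ((Matrix.GeneralLinearGroup.symSq ((x⁻¹) : GL (Fin 2) k) : GL (Fin 3) k) : Matrix (Fin
      3) (Fin 3) k) * (((Matrix.GeneralLinearGroup.symSq ((x) : GL (Fin 2) k) : GL (Fin 3) k) :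
      Matrix (Fin 3) (Fin 3) k) * f a * ((Matrix.GeneralLinearGroup.symSq ((x⁻¹) : GL (Fin 2) k) :
      GL (Fin 3) k) : Matrix (Fin 3) (Fin 3) k)) * ((Matrix.GeneralLinearGroup.symSq ((x⁻¹⁻¹) : GL
      (Fin 2) k) : GL (Fin 3) k) : Matrix (Fin 3) (Fin 3) k) := by
        rw [← conjS_mul, inv_mul_cancel, conjS_one]
    _ = ((Matrix.GeneralLinearGroup.symSq ((x⁻¹) : GL (Fin 2) k) : GL (Fin 3) k) : Matrix (Fin 3)
        (Fin 3) k) * (((Matrix.GeneralLinearGroup.symSq ((x * a * x⁻¹) : GL (Fin 2) k) : GL (Fin 3)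
        k) : Matrix (Fin 3) (Fin 3) k) * m' * ((Matrix.GeneralLinearGroup.symSq (((x * a * x⁻¹)⁻¹) :
        GL (Fin 2) k) : GL (Fin 3) k) : Matrix (Fin 3) (Fin 3) k) -
        m') * ((Matrix.GeneralLinearGroup.symSq ((x⁻¹⁻¹) : GL (Fin 2) k) : GL (Fin 3) k) : Matrix
        (Fin 3) (Fin 3) k) := by rw [key]
    _ = ((Matrix.GeneralLinearGroup.symSq ((a) : GL (Fin 2) k) : GL (Fin 3) k) : Matrix (Fin 3) (Fin
        3) k) * (((Matrix.GeneralLinearGroup.symSq ((x⁻¹) : GL (Fin 2) k) : GL (Fin 3) k) : Matrix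
        (Fin 3) (Fin 3) k) * m' * ((Matrix.GeneralLinearGroup.symSq ((x⁻¹⁻¹) : GL (Fin 2) k) : GL
        (Fin 3) k) : Matrix (Fin 3) (Fin 3) k)) * ((Matrix.GeneralLinearGroup.symSq ((a⁻¹) : GL (Fin
        2) k) : GL (Fin 3) k) : Matrix (Fin 3) (Fin 3) k) - ((Matrix.GeneralLinearGroup.symSq ((x⁻¹)
        : GL (Fin 2) k) : GL (Fin 3) k) : Matrix (Fin 3) (Fin 3)
        k) * m' * ((Matrix.GeneralLinearGroup.symSq ((x⁻¹⁻¹) : GL (Fin 2) k) : GL (Fin 3) k) :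
        Matrix (Fin 3) (Fin 3) k) := by
        rw [Matrix.mul_sub, Matrix.sub_mul, ← conjS_mul,
          show x⁻¹ * (x * a * x⁻¹) = a * x⁻¹ by group, conjS_mul]

end Conjugation

/-! ### Explicit elements of `Sym² SL₂(𝔽_l)`

The computations behind clauses (2a) and (3) of "enormous" for `Sym² H ⊇ Sym² SL₂(𝔽_l)`:
conjugation by `Sym² diag(2, 2⁻¹) = diag(4, 1, 4⁻¹)` acts on the matrix units `E_ij` of `Matrix (Fin
    3) (Fin 3) k` by
the scalars `b_ij/16`, `b = (16 64 256; 4 16 64; 1 4 16)`, so the polynomial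
`(B-64)(B-256)(B-4)(B-1)` in `B = 16 · Ad(diag(4,1,4⁻¹))` is `2073600 = 2¹⁰3⁴5²` times the
projection onto the diagonal; a matrix all of whose conjugates by `Sym²(1 ±1; 0 1)`,
`Sym²(1 0; ±1 1)` have zero diagonal vanishes; and an `Ad`-invariant trace-zero matrix is zero. -/

section Explicit


/-- `Sym²` of the lower translation `(1 0; c 1)` is `(1 0 0; 2c 1 0; c² c 1)`. [folklore] -/
theorem symSq_lower (c : k) :
    Literature.NumberTheory.EllipticCurves.TernaryPairs.symSq !![(1 : k), 0; c, 1] = (!![(1 : k), 0,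
        0; 2 * (c), 1, 0; (c) ^ 2, (c), 1] : Matrix (Fin 3) (Fin 3) k) := by
  ext i j
  fin_cases i <;> fin_cases j <;>
    simp [Literature.NumberTheory.EllipticCurves.TernaryPairs.symSq]

/-- **Conjugation by `L(c)`**, entrywise: the matrix `L(c) X L(-c)`. [folklore] -/
theorem lower3_conj (c : k) (X : Matrix (Fin 3) (Fin 3) k) :
    (!![(1 : k), 0, 0; 2 * (c), 1, 0; (c) ^ 2, (c), 1] : Matrix (Fin 3) (Fin 3) k) * X * (!![(1 :
        k), 0, 0; 2 * (-c), 1, 0; (-c) ^ 2, (-c), 1] : Matrix (Fin 3) (Fin 3) k) =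
      !![X 0 0 - 2 * c * X 0 1 + c ^ 2 * X 0 2,
          X 0 1 - c * X 0 2,
          X 0 2;
         X 1 0 + 2 * c * (X 0 0 - X 1 1) - 4 * c ^ 2 * X 0 1 + c ^ 2 * X 1 2 + 2 * c ^ 3 * X 0 2,
          X 1 1 + 2 * c * X 0 1 - c * X 1 2 - 2 * c ^ 2 * X 0 2,
          X 1 2 + 2 * c * X 0 2;
         X 2 0 + c * (X 1 0 - 2 * X 2 1) + c ^ 2 * (X 0 0 - 2 * X 1 1 + X 2 2)
            + c ^ 3 * (X 1 2 - 2 * X 0 1) + c ^ 4 * X 0 2,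
          X 2 1 + c * (X 1 1 - X 2 2) + c ^ 2 * X 0 1 - c ^ 2 * X 1 2 - c ^ 3 * X 0 2,
          X 2 2 + c ^ 2 * X 0 2 + c * X 1 2] := by
  ext i j
  simp only [Matrix.mul_apply, Fin.sum_univ_three]
  fin_cases i <;> fin_cases j <;> simp <;> ring

/-- `16 · Ad(Sym² diag(2, u))`, `2u = 1`, is conjugation by `diag(16, 4, 1)`, `diag(1, 4, 16)`.
[folklore] -/
theorem sixteen_smul_torus_conj {u : k} (h2u : 2 * u = 1) (X : Matrix (Fin 3) (Fin 3) k) :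
    (16 : k) • (diagonal ![(2 : k) ^ 2, 2 * u, u ^ 2] * X * diagonal ![u ^ 2, u * 2, (2 : k) ^ 2]) =
      diagonal ![(16 : k), 4, 1] * X * diagonal ![(1 : k), 4, 16] := by
  ext i j
  rw [Matrix.smul_apply, diagonal_conj_apply, diagonal_conj_apply, smul_eq_mul]
  fin_cases i <;> fin_cases j <;> simp [-mul_eq_mul_left_iff, -mul_eq_mul_right_iff]
  · linear_combination (16 * X 0 0 * (2 * u + 1)) * h2u
  · linear_combination (64 * X 0 1) * h2u
  · ring
  · linear_combination (4 * X 1 0 * (4 * u ^ 2 + 2 * u + 1)) * h2u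
  · linear_combination (16 * X 1 1 * (2 * u + 1)) * h2u
  · linear_combination (64 * X 1 2) * h2u
  · linear_combination (X 2 0 * (2 * u + 1) * (4 * u ^ 2 + 1)) * h2u
  · linear_combination (4 * X 2 1 * (4 * u ^ 2 + 2 * u + 1)) * h2u
  · linear_combination (16 * X 2 2 * (2 * u + 1)) * h2u

/-- The diagonal projector: with `B X = diag(16,4,1) X diag(1,4,16)`,
`(B⁴ - 325 B³ + 17988 B² - 83200 B + 65536) X = 2073600 · diag(X₀₀, X₁₁, X₂₂)`. [folklore] -/
theorem diag_projector (X : Matrix (Fin 3) (Fin 3) k) :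
    let B : Matrix (Fin 3) (Fin 3) k → Matrix (Fin 3) (Fin 3) k := fun Y => diagonal ![(16 : k), 4,
        1] * Y * diagonal ![(1 : k), 4, 16]
    B (B (B (B X))) - (325 : k) • B (B (B X)) + (17988 : k) • B (B X) - (83200 : k) • B X +
        (65536 : k) • X =
      (2073600 : k) • diagonal (fun i => X i i) := by
  intro B
  ext i j
  simp only [B, Matrix.sub_apply, Matrix.add_apply, Matrix.smul_apply, diagonal_conj_apply,
    smul_eq_mul]
  fin_cases i <;> fin_cases j <;> simp [Matrix.diagonal] <;> ring

/-- A matrix with zero diagonal whose conjugates by `Sym²(1 ±1; 0 1)` and `Sym²(1 0; ±1 1)`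
have zero diagonal is zero (`char k ≠ 2`). [folklore] -/
theorem eq_zero_of_diag_conj_eq_zero (h2 : (2 : k) ≠ 0) {X : Matrix (Fin 3) (Fin 3) k}
    (h00 : X 0 0 = 0) (h11 : X 1 1 = 0) (h22 : X 2 2 = 0)
    (hu0 : ((!![(1 : k), ((1 : k)), ((1 : k)) ^ 2; 0, 1, 2 * ((1 : k)); 0, 0, 1] : Matrix (Fin 3)
        (Fin 3) k) * X * (!![(1 : k), (-1), (-1) ^ 2; 0, 1, 2 * (-1); 0, 0, 1] : Matrix (Fin 3) (Fin
        3) k)) 0 0 = 0) (hu2 : ((!![(1 : k), ((1 : k)), ((1 : k)) ^ 2; 0, 1, 2 * ((1 : k)); 0, 0, 1]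
        : Matrix (Fin 3) (Fin 3) k) * X * (!![(1 : k), (-1), (-1) ^ 2; 0, 1, 2 * (-1); 0, 0, 1] :
        Matrix (Fin 3) (Fin 3) k)) 2 2 = 0)
    (hu'0 : ((!![(1 : k), ((-1 : k)), ((-1 : k)) ^ 2; 0, 1, 2 * ((-1 : k)); 0, 0, 1] : Matrix (Fin
        3) (Fin 3) k) * X * (!![(1 : k), (-(-1)), (-(-1)) ^ 2; 0, 1, 2 * (-(-1)); 0, 0, 1] : Matrix
        (Fin 3) (Fin 3) k)) 0 0 = 0)
    (hl0 : ((!![(1 : k), 0, 0; 2 * ((1 : k)), 1, 0; ((1 : k)) ^ 2, ((1 : k)), 1] : Matrix (Fin 3)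
        (Fin 3) k) * X * (!![(1 : k), 0, 0; 2 * (-1), 1, 0; (-1) ^ 2, (-1), 1] : Matrix (Fin 3) (Fin
        3) k)) 0 0 = 0) (hl2 : ((!![(1 : k), 0, 0; 2 * ((1 : k)), 1, 0; ((1 : k)) ^ 2, ((1 : k)), 1]
        : Matrix (Fin 3) (Fin 3) k) * X * (!![(1 : k), 0, 0; 2 * (-1), 1, 0; (-1) ^ 2, (-1), 1] :
        Matrix (Fin 3) (Fin 3) k)) 2 2 = 0)
    (hl'0 : ((!![(1 : k), 0, 0; 2 * ((-1 : k)), 1, 0; ((-1 : k)) ^ 2, ((-1 : k)), 1] : Matrix (Fin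
        3) (Fin 3) k) * X * (!![(1 : k), 0, 0; 2 * (-(-1)), 1, 0; (-(-1)) ^ 2, (-(-1)), 1] : Matrix
        (Fin 3) (Fin 3) k)) 0 0 = 0) :
    X = 0 := by
  rw [transl3_conj] at hu0 hu2 hu'0
  rw [lower3_conj] at hl0 hl2 hl'0
  simp [h00, h11, h22] at hu0 hu2 hu'0 hl0 hl2 hl'0
  have e20 : X 2 0 = 0 := by
    have : (2 : k) * X 2 0 = 0 := by linear_combination hu0 + hu'0
    exact (mul_eq_zero.mp this).resolve_left h2
  have e10 : X 1 0 = 0 := by linear_combination hu0 - e20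
  have e21 : X 2 1 = 0 := by
    have : (2 : k) * X 2 1 = 0 := by linear_combination e20 - hu2
    exact (mul_eq_zero.mp this).resolve_left h2
  have e02 : X 0 2 = 0 := by
    have : (2 : k) * X 0 2 = 0 := by linear_combination hl0 + hl'0
    exact (mul_eq_zero.mp this).resolve_left h2
  have e01 : X 0 1 = 0 := by
    have : (2 : k) * X 0 1 = 0 := by linear_combination hl'0 - e02
    exact (mul_eq_zero.mp this).resolve_left h2
  have e12 : X 1 2 = 0 := by linear_combination hl2 - e02
  ext i j
  fin_cases i <;> fin_cases j <;> assumption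

/-- An `Ad`-invariant trace-zero matrix is zero: invariance under `Sym² diag(2, 2⁻¹)` (in the
form `16 X = diag(16,4,1) X diag(1,4,16)`) kills the off-diagonal entries, invariance under
`Sym²(1 1; 0 1)` makes it scalar, and the trace condition finishes (`char k ∉ {2, 3, 5}`).
[folklore] -/
theorem eq_zero_of_invariant (h2 : (2 : k) ≠ 0) (h3 : (3 : k) ≠ 0) (h5 : (5 : k) ≠ 0) {X : Matrix
    (Fin 3) (Fin 3) k}
    (htr : X.trace = 0)
    (hD : (16 : k) • X = diagonal ![(16 : k), 4, 1] * X * diagonal ![(1 : k), 4, 16])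
    (hU : (!![(1 : k), ((1 : k)), ((1 : k)) ^ 2; 0, 1, 2 * ((1 : k)); 0, 0, 1] : Matrix (Fin 3) (Fin
        3) k) * X * (!![(1 : k), (-1), (-1) ^ 2; 0, 1, 2 * (-1); 0, 0, 1] : Matrix (Fin 3) (Fin 3)
        k) = X) : X = 0 := by
  have h12 : (12 : k) ≠ 0 := by
    rw [show (12 : k) = 2 * 2 * 3 by norm_num]; simp [h2, h3]
  have h15 : (15 : k) ≠ 0 := by
    rw [show (15 : k) = 3 * 5 by norm_num]; simp [h3, h5]
  have h48 : (48 : k) ≠ 0 := by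
    rw [show (48 : k) = 2 * 2 * 12 by norm_num]; simp [h2, h12]
  have h240 : (240 : k) ≠ 0 := by
    rw [show (240 : k) = 2 * 2 * 2 * 2 * 15 by norm_num]; simp [h2, h15]
  have e := fun i j => congrFun (congrFun hD i) j
  simp only [Matrix.smul_apply, diagonal_conj_apply, smul_eq_mul] at e
  have e01 : X 0 1 = 0 := by
    have h := e 0 1
    simp [-mul_eq_mul_left_iff, -mul_eq_mul_right_iff] at h
    have : (48 : k) * X 0 1 = 0 := by linear_combination -h
    exact (mul_eq_zero.mp this).resolve_left h48
  have e02 : X 0 2 = 0 := by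
    have h := e 0 2
    simp [-mul_eq_mul_left_iff, -mul_eq_mul_right_iff] at h
    have : (240 : k) * X 0 2 = 0 := by linear_combination -h
    exact (mul_eq_zero.mp this).resolve_left h240
  have e10 : X 1 0 = 0 := by
    have h := e 1 0
    simp [-mul_eq_mul_left_iff, -mul_eq_mul_right_iff] at h
    have : (12 : k) * X 1 0 = 0 := by linear_combination h
    exact (mul_eq_zero.mp this).resolve_left h12
  have e12 : X 1 2 = 0 := by
    have h := e 1 2
    simp [-mul_eq_mul_left_iff, -mul_eq_mul_right_iff] at h
    have : (48 : k) * X 1 2 = 0 := by linear_combination -h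
    exact (mul_eq_zero.mp this).resolve_left h48
  have e20 : X 2 0 = 0 := by
    have h := e 2 0
    simp [-mul_eq_mul_left_iff, -mul_eq_mul_right_iff] at h
    have : (15 : k) * X 2 0 = 0 := by linear_combination h
    exact (mul_eq_zero.mp this).resolve_left h15
  have e21 : X 2 1 = 0 := by
    have h := e 2 1
    simp [-mul_eq_mul_left_iff, -mul_eq_mul_right_iff] at h
    have : (12 : k) * X 2 1 = 0 := by linear_combination h
    exact (mul_eq_zero.mp this).resolve_left h12
  have f01 := congrFun (congrFun hU 0) 1
  have f12 := congrFun (congrFun hU 1) 2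
  rw [transl3_conj] at f01 f12
  simp [e01, e02, e10, e12, e20, e21, -mul_eq_mul_left_iff, -mul_eq_mul_right_iff,
    -mul_eq_zero, -zero_eq_mul] at f01 f12
  have g : X 2 2 - X 1 1 = 0 := by
    have : (2 : k) * (X 2 2 - X 1 1) = 0 := by linear_combination f12
    exact (mul_eq_zero.mp this).resolve_left h2
  rw [Matrix.trace_fin_three] at htr
  have d0 : X 0 0 = 0 := by
    have : (3 : k) * X 0 0 = 0 := by linear_combination htr - 2 * f01 - g
    exact (mul_eq_zero.mp this).resolve_left h3
  have d1 : X 1 1 = 0 := by linear_combination d0 + f01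
  have d2 : X 2 2 = 0 := by linear_combination d1 + g
  ext i j
  fin_cases i <;> fin_cases j <;> assumption

/-- `Sym² diag(2, u) = diag(4, 1, u²)`, `2u = 1`, is regular semisimple for `char k ∉ {2, 3, 5}`.
[folklore] -/
theorem separable_charpoly_torus {u : k} (h2u : 2 * u = 1) (h3 : (3 : k) ≠ 0) (h5 : (5 : k) ≠ 0) :
    (diagonal ![(2 : k) ^ 2, 2 * u, u ^ 2]).charpoly.Separable := by
  have h15 : (15 : k) ≠ 0 := by
    rw [show (15 : k) = 3 * 5 by norm_num]; simp [h3, h5]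
  have d01 : (2 : k) ^ 2 ≠ 2 * u := fun h => h3 (by linear_combination h + h2u)
  have d02 : (2 : k) ^ 2 ≠ u ^ 2 := fun h => h15 (by linear_combination (4 : k) * h + (2 * u + 1) *
      h2u)
  have d12 : (2 : k) * u ≠ u ^ 2 := fun h => h3 (by linear_combination (4 : k) * h + (2 * u - 3) *
      h2u)
  rw [Matrix.charpoly_diagonal, Polynomial.separable_prod_X_sub_C_iff]
  intro i j hij
  fin_cases i <;> fin_cases j <;> simp at hij ⊢
  · exact d01 hij
  · exact d02 hij
  · exact d01 hij.symm
  · exact d12 hij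
  · exact d02 hij.symm
  · exact d12 hij.symm

end Explicit


/-! ### Assembly: `Sym² H` is enormous -/

section Assembly

open Literature.GroupTheory.SpecificGroups
open scoped Pointwise

/-- Small numerals are non-zero in characteristic `l > 7`. [folklore] -/
theorem natCast_ne_zero_of_lt (l : ℕ) [CharP k l] {n : ℕ} (hn : 0 < n) (hnl : n < l) :
    (n : k) ≠ 0 := fun h =>
  (Nat.le_of_dvd hn ((CharP.cast_eq_zero_iff k l n).mp h)).not_gt hnl

/-- **`Sym² H ≤ GL₃(𝔽̄_l)` is enormous for `H ⊇ SL₂(𝔽_l)` finite, `l > 7`** (Allen–Calegari–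
Caraiani–Gee–Helm–Le Hung–Newton–Scholze–Taylor–Thorne, *Potential automorphy over CM
fields*, Ann. of Math. 197 (2023), Lemma 7.1.5, case `n = 3`).  Proof: by Dickson's
classification (tree: `PGL2.exists_smul_eq_or_exists_conj_eq_of_five_le`) the image of `H` in
`PGL₂` is conjugate to `PSL₂(F)` or `PGL₂(F)` for a finite subfield `F`; after conjugating, `H` is
in normal form and `card_eq_one_of_normalForm`, `exists_coboundary_of_normalForm` give
clauses (1) and (2b) (`H¹ = 0`); clauses (2a) (`H⁰ = 0`) and (3) (regular semisimple elements
with fixed vectors on every simple submodule of `ad⁰`) are read off from the elements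
`Sym² diag(2, 2⁻¹)`, `Sym²(1 ±1; 0 1)`, `Sym²(1 0; ±1 1)` of `Sym² SL₂(𝔽_l)`.
[cite: ACCGHLNSTT2023, §7.1, Lemma 7.1.5] -/
theorem isEnormous_map_symSq (l : ℕ) [Fact l.Prime] [Algebra (ZMod l) k] [IsAlgClosure (ZMod l) k]
    (H : Subgroup (GL (Fin 2) k)) (hl : 7 < l) (hH : Finite H)
    (hS : (Matrix.SpecialLinearGroup.mapGL k : SL(2, ZMod l) →* GL (Fin 2) k).range ≤ H) :
    Subgroup.IsEnormous
      (H.map (Matrix.GeneralLinearGroup.symSq : GL (Fin 2) k →* GL (Fin 3) k)) := by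
  classical
  haveI := hH
  have hlp : l.Prime := Fact.out
  haveI : CharP k l := charP_of_injective_algebraMap (algebraMap (ZMod l) k).injective l
  haveI : IsAlgClosed k := IsAlgClosure.isAlgClosed (ZMod l)
  -- small numerals
  have h2 : (2 : k) ≠ 0 := by exact_mod_cast natCast_ne_zero_of_lt l (n := 2) (by norm_num) (by
      omega)
  have h3 : (3 : k) ≠ 0 := by exact_mod_cast natCast_ne_zero_of_lt l (n := 3) (by norm_num) (by
      omega)
  have h5 : (5 : k) ≠ 0 := by exact_mod_cast natCast_ne_zero_of_lt l (n := 5) (by norm_num) (by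
      omega)
  have h7 : (7 : k) ≠ 0 := by exact_mod_cast natCast_ne_zero_of_lt l (n := 7) (by norm_num) (by
      omega)
  have hl2 : l ≠ 2 := by omega
  have hl3 : l ≠ 3 := by omega
  have hl5 : 5 ≤ l := by omega
  have h2Z : (2 : ZMod l) ≠ 0 := by
    exact_mod_cast natCast_ne_zero_of_lt (k := ZMod l) l (n := 2) (by norm_num) (by omega)
  set uu : k := (2 : k)⁻¹ with huu
  have h2u : 2 * uu = 1 := mul_inv_cancel₀ h2
  -- explicit elements of `SL₂(𝔽_l)` inside `H`
  let sU : SL(2, ZMod l) := ⟨!![1, 1; 0, 1], by simp [Matrix.det_fin_two_of]⟩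
  let sL : SL(2, ZMod l) := ⟨!![1, 0; 1, 1], by simp [Matrix.det_fin_two_of]⟩
  let sL' : SL(2, ZMod l) := ⟨!![1, 0; -1, 1], by simp [Matrix.det_fin_two_of]⟩
  let sT : SL(2, ZMod l) := ⟨!![2, 0; 0, 2⁻¹], by simp [Matrix.det_fin_two_of, mul_inv_cancel₀ h2Z]⟩
  let sT' : SL(2, ZMod l) := ⟨!![2⁻¹, 0; 0, 2], by simp [Matrix.det_fin_two_of, inv_mul_cancel₀
      h2Z]⟩
  set u : GL (Fin 2) k := Matrix.SpecialLinearGroup.mapGL k sU with hu_def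
  set v : GL (Fin 2) k := Matrix.SpecialLinearGroup.mapGL k sL with hv_def
  set v' : GL (Fin 2) k := Matrix.SpecialLinearGroup.mapGL k sL' with hv'_def
  set t : GL (Fin 2) k := Matrix.SpecialLinearGroup.mapGL k sT with ht_def
  set t' : GL (Fin 2) k := Matrix.SpecialLinearGroup.mapGL k sT' with ht'_def
  have huH : u ∈ H := hS ⟨sU, rfl⟩
  have hvH : v ∈ H := hS ⟨sL, rfl⟩
  have htH : t ∈ H := hS ⟨sT, rfl⟩
  -- their matrices
  have hu_coe : (u : Matrix (Fin 2) (Fin 2) k) = !![1, 1; 0, 1] := by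
    rw [hu_def, Matrix.SpecialLinearGroup.mapGL_coe_matrix]
    ext i j; fin_cases i <;> fin_cases j <;> simp [sU]
  have hv_coe : (v : Matrix (Fin 2) (Fin 2) k) = !![1, 0; 1, 1] := by
    rw [hv_def, Matrix.SpecialLinearGroup.mapGL_coe_matrix]
    ext i j; fin_cases i <;> fin_cases j <;> simp [sL]
  have hv'_coe : (v' : Matrix (Fin 2) (Fin 2) k) = !![1, 0; -1, 1] := by
    rw [hv'_def, Matrix.SpecialLinearGroup.mapGL_coe_matrix]
    ext i j; fin_cases i <;> fin_cases j <;> simp [sL']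
  have ht_coe : (t : Matrix (Fin 2) (Fin 2) k) = !![2, 0; 0, uu] := by
    rw [ht_def, Matrix.SpecialLinearGroup.mapGL_coe_matrix]
    ext i j; fin_cases i <;> fin_cases j <;> simp [sT, huu, map_ofNat]
  have ht'_coe : (t' : Matrix (Fin 2) (Fin 2) k) = !![uu, 0; 0, 2] := by
    rw [ht'_def, Matrix.SpecialLinearGroup.mapGL_coe_matrix]
    ext i j; fin_cases i <;> fin_cases j <;> simp [sT', huu, map_ofNat]
  have hu_eq : u = Matrix.GeneralLinearGroup.upperRightHom (1 : k) := by
    apply Units.ext; rw [hu_coe, coe_upperRightHom]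
  have hv_inv : v⁻¹ = v' := by
    rw [hv_def, hv'_def, ← map_inv]
    congr 1
    apply Subtype.ext
    rw [Matrix.SpecialLinearGroup.coe_inv]
    simp [sL, sL', Matrix.adjugate_fin_two]
  have ht_inv : t⁻¹ = t' := by
    rw [ht_def, ht'_def, ← map_inv]
    congr 1
    apply Subtype.ext
    rw [Matrix.SpecialLinearGroup.coe_inv]
    simp [sT, sT', Matrix.adjugate_fin_two]
  have hSu : ((Matrix.GeneralLinearGroup.symSq ((u) : GL (Fin 2) k) : GL (Fin 3) k) : Matrix (Fin 3)
      (Fin 3) k) = (!![(1 : k), ((1 : k)), ((1 : k)) ^ 2; 0, 1, 2 * ((1 : k)); 0, 0, 1] : Matrix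
      (Fin 3) (Fin 3) k) := by rw [hu_eq, symSqMat_upperRightHom]
  have hSu' : ((Matrix.GeneralLinearGroup.symSq ((u⁻¹) : GL (Fin 2) k) : GL (Fin 3) k) : Matrix (Fin
      3) (Fin 3) k) = (!![(1 : k), (-(1 : k)), (-(1 : k)) ^ 2; 0, 1, 2 * (-(1 : k)); 0, 0, 1] :
      Matrix (Fin 3) (Fin 3) k) := by rw [hu_eq, symSqMat_upperRightHom_inv]
  have hSv : ((Matrix.GeneralLinearGroup.symSq ((v) : GL (Fin 2) k) : GL (Fin 3) k) : Matrix (Fin 3)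
      (Fin 3) k) = !![(1 : k), 0, 0; 2 * 1, 1, 0; 1 ^ 2, 1, 1] := by
    rw [Matrix.GeneralLinearGroup.coe_symSq, hv_coe, symSq_lower]
  have hSv' : ((Matrix.GeneralLinearGroup.symSq ((v⁻¹) : GL (Fin 2) k) : GL (Fin 3) k) : Matrix (Fin
      3) (Fin 3) k) = !![(1 : k), 0, 0; 2 * (-1), 1, 0; (-1) ^ 2, -1, 1] := by
    rw [hv_inv, Matrix.GeneralLinearGroup.coe_symSq, hv'_coe, symSq_lower]
  have hSt : ((Matrix.GeneralLinearGroup.symSq ((t) : GL (Fin 2) k) : GL (Fin 3) k) : Matrix (Fin 3)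
      (Fin 3) k) = diagonal ![(2 : k) ^ 2, 2 * uu, uu ^ 2] := by
    rw [symSqMat_of_diag (by rw [ht_coe]; simp) (by rw [ht_coe]; simp), ht_coe]
    simp
  have hSt' : ((Matrix.GeneralLinearGroup.symSq ((t⁻¹) : GL (Fin 2) k) : GL (Fin 3) k) : Matrix (Fin
      3) (Fin 3) k) = diagonal ![uu ^ 2, uu * 2, (2 : k) ^ 2] := by
    rw [ht_inv, symSqMat_of_diag (by rw [ht'_coe]; simp) (by rw [ht'_coe]; simp), ht'_coe]
    simp
  -- Dickson: the image of `H` in `PGL₂` is conjugate to `PSL₂(F)` or `PGL₂(F)`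
  set Hbar := H.map (Matrix.ProjGenLinGroup.mk : GL (Fin 2) k →* PGL(Fin 2, k)) with hHbar
  haveI : Finite Hbar := Finite.of_surjective _ (MonoidHom.subgroupMap_surjective _ H)
  have hτ : PGL2.transl (1 : k) ∈ Hbar := by
    rw [PGL2.transl_apply, ← hu_eq]; exact Subgroup.mem_map_of_mem _ huH
  have hord : orderOf (PGL2.transl (1 : k)) = l := by
    refine orderOf_eq_prime ?_ ?_
    · rw [← AddChar.map_nsmul_eq_pow, nsmul_eq_mul, mul_one, CharP.cast_eq_zero,
        AddChar.map_zero_eq_one]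
    · rw [Ne, PGL2.transl_eq_one_iff]; exact one_ne_zero
  have hdvd : l ∣ Nat.card Hbar := by
    rw [← hord, ← Subgroup.orderOf_mk (PGL2.transl (1 : k)) hτ]
    exact orderOf_dvd_natCard _
  obtain ⟨x0, hx0⟩ | ⟨F, tP, hFfin, hconj⟩ :=
    PGL2.exists_smul_eq_or_exists_conj_eq_of_five_le l hl5 Hbar hdvd
  · exfalso
    have h1 := hx0 _ hτ
    have hvbar : Matrix.ProjGenLinGroup.mk v ∈ Hbar := Subgroup.mem_map_of_mem _ hvH
    have h2' := hx0 _ hvbar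
    cases x0 with
    | infty =>
      rw [PGL2.mk_smul_infty_eq_self_iff] at h2'
      have : (v : Matrix (Fin 2) (Fin 2) k) 1 0 = 1 := by rw [hv_coe]; simp
      exact one_ne_zero (this.symm.trans h2')
    | coe z =>
      rw [PGL2.transl_smul_coe, OnePoint.coe_eq_coe] at h1
      exact one_ne_zero (add_eq_left.mp h1)
  haveI := hFfin
  -- conjugate `H` into normal form
  obtain ⟨x, rfl⟩ := Matrix.ProjGenLinGroup.mk_surjective tP
  set H' : Subgroup (GL (Fin 2) k) := MulAut.conj x • H with hH'
  haveI : Finite H' := Finite.of_equiv _ (Subgroup.equivSMul (MulAut.conj x) H).toEquiv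
  have hmap' : H'.map Matrix.ProjGenLinGroup.mk = PGL2.pslTwo F ∨
      H'.map Matrix.ProjGenLinGroup.mk = PGL2.pglTwo F := by
    rw [hH', map_mk_conj_smul]; exact hconj
  have hle1 : PGL2.pslTwo F ≤ H'.map Matrix.ProjGenLinGroup.mk := by
    rcases hmap' with h | h <;> rw [h]
    exact PGL2.pslTwo_le_pglTwo F
  have hle2 : H'.map Matrix.ProjGenLinGroup.mk ≤ PGL2.pglTwo F := by
    rcases hmap' with h | h <;> rw [h]
    exact PGL2.pslTwo_le_pglTwo F
  have hU := hasTransl_of_pslTwo_le l H' F hle1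
  have hT := hasTorus_of_pslTwo_le H' F hle1
  have hF := isRational_of_le_pglTwo H' F hle2
  haveI : Finite (H' ⊓ (MulAction.stabilizer (GL (Fin 2) k) (∞ : OnePoint k) ⊓
      MulAction.stabilizer (GL (Fin 2) k) (((0 : k)) : OnePoint k)) : Subgroup (GL (Fin 2) k)) :=
    Finite.of_injective _ (Subgroup.inclusion_injective inf_le_left)
  have hD' : ¬ l ∣ Nat.card (H' ⊓ (MulAction.stabilizer (GL (Fin 2) k) (∞ : OnePoint k) ⊓
      MulAction.stabilizer (GL (Fin 2) k) (((0 : k)) : OnePoint k)) : Subgroup (GL (Fin 2) k)) :=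
    not_dvd_card_of_diag l _ (fun g hg => mem_diag_iff.mp (Subgroup.mem_inf.mp hg).2)
  have hidx' : ¬ l ∣ (H' ⊓ MulAction.stabilizer (GL (Fin 2) k) (∞ : OnePoint k)).relIndex H' :=
    not_dvd_relIndex_borel l H' F hU (not_dvd_card_of_eq_pslTwo_or l hl2 F hmap')
  have hDk : ((Nat.card (H' ⊓ (MulAction.stabilizer (GL (Fin 2) k) (∞ : OnePoint k) ⊓
      MulAction.stabilizer (GL (Fin 2) k) (((0 : k)) : OnePoint k)) : Subgroup (GL (Fin
          2) k)) : ℕ) :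
        k) ≠ 0 := by
    rwa [Ne, CharP.cast_eq_zero_iff k l]
  have hidxk : (((H' ⊓ MulAction.stabilizer (GL (Fin 2) k) (∞ : OnePoint k)).relIndex H' : ℕ) :
      k) ≠ 0 := by
    rwa [Ne, CharP.cast_eq_zero_iff k l]
  -- the main consequences for `H` itself
  have hH1 : ∀ f : GL (Fin 2) k → Matrix (Fin 3) (Fin 3) k, (∀ a₁ ∈ ((H) : Subgroup (GL (Fin 2) k)),
      ∀ b₁ ∈ (H), ((f) : GL (Fin 2) k → Matrix (Fin 3) (Fin 3) k) (a₁ * b₁) =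
      ((Matrix.GeneralLinearGroup.symSq ((a₁) : GL (Fin 2) k) : GL (Fin 3) k) : Matrix (Fin 3) (Fin
      3) k) * (f) b₁ * ((Matrix.GeneralLinearGroup.symSq ((a₁⁻¹) : GL (Fin 2) k) : GL (Fin 3) k) :
      Matrix (Fin 3) (Fin 3) k) + (f) a₁) →
      ∃ m : Matrix (Fin 3) (Fin 3) k, ∀ a ∈ H, f a = ((Matrix.GeneralLinearGroup.symSq ((a) : GL
          (Fin 2) k) : GL (Fin 3) k) : Matrix (Fin 3) (Fin 3)
          k) * m * ((Matrix.GeneralLinearGroup.symSq ((a⁻¹) : GL (Fin 2) k) : GL (Fin 3) k) : Matrix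
          (Fin 3) (Fin 3) k) - m := fun f hf =>
    exists_coboundary_of_conj x
      (fun f' hf' => exists_coboundary_of_normalForm h2 h3 h5 h7 H' F hU hT hF hDk hidxk hf') hf
  set G := H.map (Matrix.GeneralLinearGroup.symSq : GL (Fin 2) k →* GL (Fin 3) k) with hG
  haveI : Finite G := Finite.of_surjective _ (MonoidHom.subgroupMap_surjective _ H)
  refine ⟨?_, ?_, ?_, ?_⟩
  · -- (1) no `l`-group quotient
    intro N _ a hcard
    rw [ringChar.eq k l] at hcard
    haveI : Finite (G ⧸ N) := Finite.of_surjective _ (QuotientGroup.mk'_surjective N)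
    have hQ : IsPGroup l (G ⧸ N) := IsPGroup.of_card hcard
    let ψ : H' →* G ⧸ N :=
      ((QuotientGroup.mk' N).comp (Matrix.GeneralLinearGroup.symSq.subgroupMap H)).comp
        (Subgroup.equivSMul (MulAut.conj x) H).symm.toMonoidHom
    have hψ : Function.Surjective ψ :=
      ((QuotientGroup.mk'_surjective N).comp (MonoidHom.subgroupMap_surjective _ _)).comp
        (MulEquiv.surjective _)
    have h1 := card_eq_one_of_normalForm l hl3 h2 H' F hU hT hF hD' hidx' hQ ψ hψ
    rw [hcard] at h1
    exact (Nat.pow_eq_one.mp h1).resolve_left hlp.one_lt.ne'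
  · -- (2a) `H⁰ = 0`
    rw [eq_bot_iff]
    intro M hM
    rw [Representation.mem_invariants] at hM
    rw [Submodule.mem_bot]
    apply Subtype.ext
    have hinv : ∀ a ∈ H, ((Matrix.GeneralLinearGroup.symSq ((a) : GL (Fin 2) k) : GL (Fin 3) k) :
        Matrix (Fin 3) (Fin 3) k) * (M : Matrix (Fin 3) (Fin 3)
        k) * ((Matrix.GeneralLinearGroup.symSq ((a⁻¹) : GL (Fin 2) k) : GL (Fin 3) k) : Matrix (Fin
        3) (Fin 3) k) = M := fun a ha => by
      have h := congrArg Subtype.val (hM ⟨Matrix.GeneralLinearGroup.symSq a,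
        Subgroup.mem_map_of_mem _ ha⟩)
      rw [Subgroup.coe_adZeroRep_apply] at h
      rwa [← map_inv] at h
    refine eq_zero_of_invariant h2 h3 h5 M.2 ?_ ?_
    · rw [← sixteen_smul_torus_conj h2u, ← hSt, ← hSt', hinv t htH]
    · rw [← hSu, ← hSu', hinv u huH]
  · -- (2b) `H¹ = 0`
    intro f hf
    rw [groupCohomology.mem_cocycles₁_iff] at hf
    set f₂ : GL (Fin 2) k → Matrix (Fin 3) (Fin 3) k := fun a =>
      if ha : a ∈ H then ((f ⟨Matrix.GeneralLinearGroup.symSq a, Subgroup.mem_map_of_mem _ ha⟩ :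
        (adZero (Fin 3) k).toSubmodule) : Matrix (Fin 3) (Fin 3) k) else 0 with hf₂
    have hf₂c : (∀ a₁ ∈ ((H) : Subgroup (GL (Fin 2) k)), ∀ b₁ ∈ (H), ((f₂) : GL (Fin 2) k → Matrix
        (Fin 3) (Fin 3) k) (a₁ * b₁) = ((Matrix.GeneralLinearGroup.symSq ((a₁) : GL (Fin 2) k) : GL
        (Fin 3) k) : Matrix (Fin 3) (Fin 3) k) * (f₂) b₁ * ((Matrix.GeneralLinearGroup.symSq ((a₁⁻¹)
        : GL (Fin 2) k) : GL (Fin 3) k) : Matrix (Fin 3) (Fin 3) k) + (f₂) a₁) := by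
      intro a ha b hb
      have hab := H.mul_mem ha hb
      simp only [hf₂, dif_pos ha, dif_pos hb, dif_pos hab]
      have hmul : (⟨Matrix.GeneralLinearGroup.symSq (a * b), Subgroup.mem_map_of_mem _ hab⟩ : G) =
          ⟨Matrix.GeneralLinearGroup.symSq a, Subgroup.mem_map_of_mem _ ha⟩ *
            ⟨Matrix.GeneralLinearGroup.symSq b, Subgroup.mem_map_of_mem _ hb⟩ :=
        Subtype.ext (map_mul _ a b)
      rw [hmul, hf, Submodule.coe_add, Rep.of_ρ, Subgroup.coe_adZeroRep_apply, ← map_inv]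
    obtain ⟨m, hm⟩ := hH1 f₂ hf₂c
    -- make `m` trace-free
    set m₀ : Matrix (Fin 3) (Fin 3) k := m - (m.trace / 3) • (1 : Matrix (Fin 3) (Fin 3) k) with hm₀
    have hm₀tr : m₀ ∈ (adZero (Fin 3) k).toSubmodule := by
      rw [mem_adZero_toSubmodule_iff, hm₀, Matrix.trace_sub, Matrix.trace_smul, Matrix.trace_one,
        Fintype.card_fin, smul_eq_mul]
      push_cast
      field_simp
      ring
    have hm₀' : ∀ a : GL (Fin 2) k, ((Matrix.GeneralLinearGroup.symSq ((a) : GL (Fin 2) k) : GL (Fin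
        3) k) : Matrix (Fin 3) (Fin 3) k) * m₀ * ((Matrix.GeneralLinearGroup.symSq ((a⁻¹) : GL (Fin
        2) k) : GL (Fin 3) k) : Matrix (Fin 3) (Fin 3) k) - m₀ = ((Matrix.GeneralLinearGroup.symSq
        ((a) : GL (Fin 2) k) : GL (Fin 3) k) : Matrix (Fin 3) (Fin 3)
        k) * m * ((Matrix.GeneralLinearGroup.symSq ((a⁻¹) : GL (Fin 2) k) : GL (Fin 3) k) : Matrix
        (Fin 3) (Fin 3) k) - m := by
      intro a
      rw [hm₀, Matrix.mul_sub, Matrix.sub_mul, Matrix.mul_smul, Matrix.smul_mul, Matrix.mul_one,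
        symSqMat_mul_inv]
      abel
    refine ⟨⟨m₀, hm₀tr⟩, ?_⟩
    funext g
    rcases g with ⟨g, hg⟩
    obtain ⟨a, ha, rfl⟩ := Subgroup.mem_map.mp hg
    rw [groupCohomology.d₀₁_hom_apply]
    apply Subtype.ext
    rw [Submodule.coe_sub, Rep.of_ρ, Subgroup.coe_adZeroRep_apply]
    change ((Matrix.GeneralLinearGroup.symSq ((a) : GL (Fin 2) k) : GL (Fin 3) k) : Matrix (Fin 3)
        (Fin 3) k) * m₀ * _ - m₀ = _
    rw [← map_inv, hm₀' a, ← hm a ha]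
    simp only [hf₂, dif_pos ha]
  · -- (3) regular semisimple elements with fixed vectors
    intro W hW
    set tt : G := ⟨Matrix.GeneralLinearGroup.symSq t, Subgroup.mem_map_of_mem _ htH⟩ with htt
    refine ⟨tt, ?_, ?_⟩
    · change (((Matrix.GeneralLinearGroup.symSq ((t) : GL (Fin 2) k) : GL (Fin 3) k) : Matrix (Fin
        3) (Fin 3) k)).charpoly.Separable
      rw [hSt]
      exact separable_charpoly_torus h2u h3 h5
    · -- conjugates stay in `W`
      have hWρ : ∀ (g : GL (Fin 2) k) (hg : g ∈ H), ∀ w ∈ W,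
          Subgroup.adZeroRep G ⟨Matrix.GeneralLinearGroup.symSq g, Subgroup.mem_map_of_mem _
              hg⟩ w ∈ W :=
        fun g hg w hw => W.apply_mem_toSubmodule _ hw
      have hρcoe : ∀ (g : GL (Fin 2) k) (hg : g ∈ H) (w : (adZero (Fin 3) k).toSubmodule),
          ((Subgroup.adZeroRep G ⟨Matrix.GeneralLinearGroup.symSq g, Subgroup.mem_map_of_mem _ hg⟩
            w : (adZero (Fin 3)
                k).toSubmodule) : Matrix (Fin 3) (Fin 3) k) = ((Matrix.GeneralLinearGroup.symSq ((g)
                : GL (Fin 2) k) : GL (Fin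
                3) k) : Matrix (Fin 3) (Fin 3) k) * (w : Matrix (Fin 3) (Fin 3) k) * ((Matrix.GeneralLinearGroup.symSq ((g⁻¹)
                : GL (Fin 2) k) : GL (Fin 3) k) : Matrix (Fin 3) (Fin 3) k) := by
        intro g hg w
        rw [Subgroup.coe_adZeroRep_apply, ← map_inv]
      -- Step A: the diagonal part of any `w ∈ W` lies in `W` (up to the unit `2073600`)
      set Bop : (adZero (Fin 3) k).toSubmodule → (adZero (Fin 3) k).toSubmodule :=
        fun w => (16 : k) • Subgroup.adZeroRep G tt w with hBop
      have hBopW : ∀ w ∈ W, Bop w ∈ W := fun w hw => W.toSubmodule.smul_mem _ (hWρ t htH w hw)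
      have hBopcoe : ∀ w : (adZero (Fin 3) k).toSubmodule, ((Bop w : (adZero (Fin 3) k).toSubmodule)
          :
          Matrix (Fin 3) (Fin 3) k) = diagonal ![(16 : k), 4, 1] * (w : Matrix (Fin 3) (Fin
              3) k) * diagonal ![(1 : k), 4, 16] := by
        intro w
        rw [hBop]
        dsimp only
        rw [Submodule.coe_smul, hρcoe t htH, hSt, hSt', sixteen_smul_torus_conj h2u]
      have hdiagW : ∀ w ∈ W, ∃ p ∈ W, ((p : (adZero (Fin 3) k).toSubmodule) : Matrix (Fin 3) (Fin 3)
          k) =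
          (2073600 : k) • diagonal (fun i => (w : Matrix (Fin 3) (Fin 3) k) i i) := by
        intro w hw
        refine ⟨Bop (Bop (Bop (Bop w))) - (325 : k) • Bop (Bop (Bop w)) + (17988 : k) • Bop (Bop w)
          - (83200 : k) • Bop w + (65536 : k) • w, ?_, ?_⟩
        · have h1 := hBopW w hw
          have h2' := hBopW _ h1
          have h3' := hBopW _ h2'
          have h4' := hBopW _ h3'
          exact W.toSubmodule.add_mem (W.toSubmodule.sub_mem (W.toSubmodule.add_mem
            (W.toSubmodule.sub_mem h4' (W.toSubmodule.smul_mem _ h3'))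
            (W.toSubmodule.smul_mem _ h2')) (W.toSubmodule.smul_mem _ h1))
            (W.toSubmodule.smul_mem _ hw)
        · simp only [Submodule.coe_add, Submodule.coe_sub, Submodule.coe_smul, hBopcoe]
          exact diag_projector (w : Matrix (Fin 3) (Fin 3) k)
      -- Step B: some `w ∈ W` has a non-zero diagonal entry
      have hex : ∃ w ∈ W, ∃ i, (w : Matrix (Fin 3) (Fin 3) k) i i ≠ 0 := by
        by_contra hcon
        push Not at hcon
        apply hW.1
        apply Subrepresentation.toSubmodule_injective
        change W.toSubmodule = ⊥
        rw [eq_bot_iff]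
        intro w hw
        rw [Submodule.mem_bot]
        apply Subtype.ext
        have zd : ∀ w ∈ W, (w : Matrix (Fin 3) (Fin 3) k) 0 0 = 0 ∧ (w : Matrix (Fin 3) (Fin 3)
            k) 1 1 = 0 ∧ (w : Matrix (Fin 3) (Fin 3) k) 2 2 = 0 :=
          fun w hw => ⟨hcon w hw 0, hcon w hw 1, hcon w hw 2⟩
        obtain ⟨z0, z1, z2⟩ := zd w hw
        have cu := zd _ (hWρ u huH w hw)
        have cu' := zd _ (hWρ u⁻¹ (H.inv_mem huH) w hw)
        have cv := zd _ (hWρ v hvH w hw)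
        have cv' := zd _ (hWρ v⁻¹ (H.inv_mem hvH) w hw)
        rw [hρcoe u huH, hSu, hSu'] at cu
        rw [hρcoe u⁻¹ (H.inv_mem huH), inv_inv, hSu, hSu'] at cu'
        rw [hρcoe v hvH, hSv, hSv'] at cv
        rw [hρcoe v⁻¹ (H.inv_mem hvH), inv_inv, hSv, hSv'] at cv'
        exact eq_zero_of_diag_conj_eq_zero h2 z0 z1 z2 cu.1 cu.2.2 (by simpa using
            cu'.1) cv.1 cv.2.2
          (by simpa using cv'.1)
      -- Step C: the diagonal part is a non-zero `tt`-fixed vector in `W`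
      obtain ⟨w, hw, i, hi⟩ := hex
      obtain ⟨p, hp, hpcoe⟩ := hdiagW w hw
      have hc : (2073600 : k) ≠ 0 := by
        rw [show (2073600 : k) = 2 ^ 10 * 3 ^ 4 * 5 ^ 2 by norm_num]
        simp [h2, h3, h5]
      refine ⟨p, hp, ?_, ?_⟩
      · intro hp0
        have h0 := congrFun (congrFun (congrArg Subtype.val hp0) i) i
        rw [hpcoe] at h0
        simp [Matrix.diagonal] at h0
        rcases h0 with h0 | h0
        · exact hc h0
        · exact hi h0
      · apply Subtype.ext
        rw [hρcoe t htH, hpcoe, hSt, hSt', Matrix.mul_smul, Matrix.smul_mul,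
          Matrix.diagonal_mul_diagonal, Matrix.diagonal_mul_diagonal]
        congr 1
        rw [show (fun i => ![(2 : k) ^ 2, 2 * uu, uu ^ 2] i * (w : Matrix (Fin 3) (Fin 3) k) i i *
            ![uu ^ 2, uu * 2, (2 : k) ^ 2] i) = fun i => (w : Matrix (Fin 3) (Fin 3) k) i i from ?_]
        funext j
        fin_cases j <;> simp
        · linear_combination ((w : Matrix (Fin 3) (Fin 3) k) 0 0 * (2 * uu + 1)) * h2u
        · linear_combination ((w : Matrix (Fin 3) (Fin 3) k) 1 1 * (2 * uu + 1)) * h2u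
        · linear_combination ((w : Matrix (Fin 3) (Fin 3) k) 2 2 * (2 * uu + 1)) * h2u

end Assembly

end SymmSqEnormous

end Literature.NumberTheory.GaloisRepresentations
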